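import Mathlib.Topology.Order.Basic
import Literature.Probability.Percolation.RhombicTilingSides
import HarnessLib

/-!
# Planarity of rhombic tilings: across a side, fault lines, edge-to-edge

Umbrella file (parts III–V of the planarity series begun in `RhombicTilingPlanarity` and
`RhombicTilingSides`). For an isoradial embedding with the tiling condition `IsRhombicTiling`
and bounded angles BAP(ε), `ε > 0`, of a **preconnected** graph `G`:

* Part III (local finiteness and the rhombus across a side): `finite_setOf_rhombus_inter_closedBall`,
  `exists_rhombus_across_side`, `rhombus_subset_sideOuter`;
* Part IV (the fault-line argument): **no corner of a rhombus lies in an open side of a rhombus**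
  (`corner_not_mem_openSegment_side`) — otherwise the line of that side is a fault line and `G`
  is disconnected (`FaultLine.false_of_fault`);
* Part V (edge-to-edge): across every side of every rhombus lies exactly one other rhombus, with
  the same segment as a side (`existsUnique_acrossEdge`, `acrossEdge`).

This is the combinatorial half of Grimmett–Manolescu's standing assumption (PTRF 159 (2014) =
arXiv:1204.0505, §4.1) that the diamond graph `G^◇` is "a planar graph embedded in `ℝ²` such
that every face is a rhombus", which the tree's `IsRhombicTiling` (disjoint interiors + cover +
`c` injective) does not record; the other half (corner consistency) is the sequel
`RhombicTilingCornerConsistency`. The three parts keep their own module docstrings below.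
-/

/-!
# Planarity of rhombic tilings, III: local finiteness and the rhombus across a side

Topic `Literature/Probability/Percolation`. For an isoradial embedding `emb : RhombicEmbedding G F`
satisfying the tiling condition `IsRhombicTiling` (disjoint interiors, covering, `c` injective)
and the bounded-angles property BAP(ε), `ε > 0`, this file turns the one-rhombus geometry of
`RhombicTilingSides` into statements about the tiling (Grimmett–Manolescu 2014, §4.1: the
diamond graph `G^◇` as a rhombic tiling of the plane; de Bruijn 1981, §4):

* `exists_isQuad_of_mem_dartSides` — each of the four sides `(v, f) ∈ dartSides d` of the
  rhombus of a dart `d` is the side `[A', P'] = [z v, c f]` of a re-labelling of its corners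
  satisfying `IsQuad`, with the same hull and the same centre `dartCentre d`;
* `rhombus_subset_sideInner`, `exists_ball_inter_sideInner_subset` — supporting half-plane and
  half-discs for the sides of the rhombi of the tiling (`sideInner`, `sideOuter`: the closed
  half-planes of a side containing / not containing the centre);
* `rhombus_subset_closedBall_mid`, `finite_setOf_mid_boxNorm_le`,
  `finite_setOf_rhombus_inter_closedBall` — **local finiteness**: only finitely many rhombi meet
  a bounded set (midpoints of distinct edges are `sin² ε`-separated,
  `IsoradialCriticality.le_boxNorm_mid_sub_mid`);
* `exists_rhombus_mem_of_tendsto` — **pigeonhole**: a convergent sequence of points, each in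
  some rhombus, has its limit in a rhombus that contains infinitely many of them;
* `exists_rhombus_across_side` — **the rhombus across a side**: every point of an open side of a
  rhombus lies in some *other* rhombus (covering + local finiteness + closedness);
* `rhombus_subset_sideOuter` — **across a side**: any other rhombus containing a point of an
  open side of the rhombus of `d` lies in the closed outer half-plane of that side (disjoint
  interiors);
* `corner_not_mem_openSegment_self` — no corner of a rhombus lies in one of its own open sides.

These are the local ingredients of the fault-line argument (no T-junctions) and of de Bruijn's
tracks in the sequel files.

## References

* G. R. Grimmett, I. Manolescu, *Bond percolation on isoradial graphs*, PTRF 159 (2014),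
  arXiv:1204.0505, §2.1, §4.1.
* N. G. de Bruijn, *Algebraic theory of Penrose's non-periodic tilings of the plane*, Indag.
  Math. 43 (1981), §4.
* R. Kenyon, J.-M. Schlenker, *Rhombic embeddings of planar quad-graphs*, TAMS 357 (2005), §3.
-/

noncomputable section

open Complex ComplexConjugate Metric Set Filter Topology

namespace Literature.Probability.Percolation

open Literature.Probability.LatticeModels IsoradialCriticality

variable {V F : Type*} {G : SimpleGraph V} {emb : RhombicEmbedding G F}

/-! ### The sides of the rhombus of a dart -/

section Sides

/-- The centre of the rhombus of the dart `d = (x → y)`: the midpoint `(z x + z y) / 2` of its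
primal diagonal (also of its dual diagonal). [cite: GrimmettManolescu2014Isoradial, §2.1 (the rhombus A O₁ B O₂)] -/
def _root_.Literature.Probability.LatticeModels.RhombicEmbedding.dartCentre
    (emb : RhombicEmbedding G F) (d : G.Dart) : ℂ :=
  (emb.z d.fst + emb.z d.snd) / 2

/-- The closed **inner half-plane** of the side `p = (v, f)` of the rhombus of `d`: the points on
the (weak) side of the line through `z v` and `c f` that contains the centre of the rhombus.
[cite: GrimmettManolescu2014Isoradial, §4.1 (rhombic tilings of the plane)] -/
def _root_.Literature.Probability.LatticeModels.RhombicEmbedding.sideInner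
    (emb : RhombicEmbedding G F) (d : G.Dart) (p : V × F) : Set ℂ :=
  {Y | 0 ≤ sideFn (emb.z p.1) (emb.c p.2) Y * sideFn (emb.z p.1) (emb.c p.2) (emb.dartCentre d)}

/-- The closed **outer half-plane** of the side `p = (v, f)` of the rhombus of `d`: the points on
the (weak) side of the line through `z v` and `c f` not containing the centre.
[cite: GrimmettManolescu2014Isoradial, §4.1 (rhombic tilings of the plane)] -/
def _root_.Literature.Probability.LatticeModels.RhombicEmbedding.sideOuter
    (emb : RhombicEmbedding G F) (d : G.Dart) (p : V × F) : Set ℂ :=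
  {Y | sideFn (emb.z p.1) (emb.c p.2) Y * sideFn (emb.z p.1) (emb.c p.2) (emb.dartCentre d) ≤ 0}

/-- The rhombus of a dart read off the dart satisfies `IsQuad`. [cite: GrimmettManolescu2014Isoradial, §2.1 (the rhombus A O₁ B O₂)] -/
theorem dart_isQuad (hiso : emb.IsIsoradial) (d : G.Dart) :
    IsQuad (emb.z d.fst) (emb.c (emb.leftFace d)) (emb.z d.snd) (emb.c (emb.rightFace d)) := by
  obtain ⟨hsum, hAB, hPQ, hAP, hBP⟩ := dart_quad hiso d
  exact ⟨hsum, hAB, hPQ, hAP, hBP⟩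

/-- The side functional of a side at the centre is half its value at the opposite primal corner
`B'`. [folklore] -/
theorem sideFn_dartCentre {d : G.Dart} {p : V × F} {B' : ℂ}
    (hB : emb.z p.1 + B' = emb.z d.fst + emb.z d.snd) :
    sideFn (emb.z p.1) (emb.c p.2) (emb.dartCentre d) = sideFn (emb.z p.1) (emb.c p.2) B' / 2 := by
  have : emb.dartCentre d = (1 / 2 : ℝ) • emb.z p.1 + (1 / 2 : ℝ) • B' := by
    simp only [RhombicEmbedding.dartCentre, ← hB, Complex.real_smul]; push_cast; ring
  rw [this, sideFn_combo _ _ _ _ (by norm_num : (1 / 2 : ℝ) + 1 / 2 = 1), sideFn_left]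
  ring

variable [DecidableEq V] [DecidableEq F]

/-- Membership in `dartSides d`, unfolded. [folklore] -/
theorem mem_dartSides_iff (d : G.Dart) (p : V × F) :
    p ∈ emb.dartSides d ↔ p = (d.fst, emb.leftFace d) ∨ p = (d.snd, emb.leftFace d) ∨
      p = (d.snd, emb.rightFace d) ∨ p = (d.fst, emb.rightFace d) := by
  simp only [RhombicEmbedding.dartSides, Finset.mem_insert, Finset.mem_singleton]

/-- **Every side is the side `[A', P']` of a re-labelled rhombus.** For `p = (v, f) ∈ dartSides d`
there are corners `B' ∈ {z x, z y}` and `Q' ∈ {c f', c g'}` of the rhombus of `d` such that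
`(z v, c f, B', Q')` satisfies `IsQuad`, has the same hull, and `z v + B' = z x + z y` (so the
centre is `dartCentre d`). [cite: GrimmettManolescu2014Isoradial, §2.1 (the rhombus A O₁ B O₂)] -/
theorem exists_isQuad_of_mem_dartSides (hiso : emb.IsIsoradial) (d : G.Dart) {p : V × F}
    (hp : p ∈ emb.dartSides d) :
    ∃ B' Q', IsQuad (emb.z p.1) (emb.c p.2) B' Q' ∧
      convexHull ℝ ({emb.z p.1, emb.c p.2, B', Q'} : Set ℂ) = emb.rhombus ⟨d.edge, d.edge_mem⟩ ∧
      ({emb.z p.1, B'} : Set ℂ) = {emb.z d.fst, emb.z d.snd} ∧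
      ({emb.c p.2, Q'} : Set ℂ) = {emb.c (emb.leftFace d), emb.c (emb.rightFace d)} ∧
      emb.z p.1 + B' = emb.z d.fst + emb.z d.snd := by
  have hq := dart_isQuad hiso d
  rw [rhombus_dart_eq hiso d]
  rcases (mem_dartSides_iff d p).1 hp with rfl | rfl | rfl | rfl
  · exact ⟨_, _, hq, rfl, rfl, rfl, rfl⟩
  · exact ⟨_, _, hq.swapAB, IsQuad.hull_swapAB _ _ _ _, Set.pair_comm _ _, rfl, add_comm _ _⟩
  · refine ⟨_, _, hq.swapAB.swapPQ, ?_, Set.pair_comm _ _, Set.pair_comm _ _, add_comm _ _⟩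
    rw [IsQuad.hull_swapPQ, IsQuad.hull_swapAB]
  · exact ⟨_, _, hq.swapPQ, IsQuad.hull_swapPQ _ _ _ _, rfl, Set.pair_comm _ _, rfl⟩

/-- Sides have unit length. [cite: GrimmettManolescu2014Isoradial, §2.1 (unit rhombi)] -/
theorem norm_side_eq_one (hiso : emb.IsIsoradial) (d : G.Dart) {p : V × F}
    (hp : p ∈ emb.dartSides d) : ‖emb.z p.1 - emb.c p.2‖ = 1 := by
  obtain ⟨B', Q', hq, -, -, -, -⟩ := exists_isQuad_of_mem_dartSides hiso d hp
  exact hq.norm_AP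

/-- The endpoints of a side are distinct. [folklore] -/
theorem z_ne_c_of_mem_dartSides (hiso : emb.IsIsoradial) (d : G.Dart) {p : V × F}
    (hp : p ∈ emb.dartSides d) : emb.z p.1 ≠ emb.c p.2 := by
  obtain ⟨B', Q', hq, -, -, -, -⟩ := exists_isQuad_of_mem_dartSides hiso d hp
  exact hq.A_ne_P

/-- The side functional of a side does not vanish at the centre (the centre is off every side
line). [folklore] -/
theorem sideFn_dartCentre_ne_zero (hiso : emb.IsIsoradial) (d : G.Dart) {p : V × F}
    (hp : p ∈ emb.dartSides d) : sideFn (emb.z p.1) (emb.c p.2) (emb.dartCentre d) ≠ 0 := by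
  obtain ⟨B', Q', hq, -, -, -, hB⟩ := exists_isQuad_of_mem_dartSides hiso d hp
  rw [sideFn_dartCentre hB]
  exact div_ne_zero hq.sideFn_APB_ne_zero two_ne_zero

/-- **Supporting half-plane**: the rhombus of `d` lies in the inner half-plane of each of its
sides. [cite: GrimmettManolescu2014Isoradial, §4.1 (rhombic tilings of the plane)] -/
theorem rhombus_subset_sideInner (hiso : emb.IsIsoradial) (d : G.Dart) {p : V × F}
    (hp : p ∈ emb.dartSides d) : emb.rhombus ⟨d.edge, d.edge_mem⟩ ⊆ emb.sideInner d p := by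
  obtain ⟨B', Q', hq, hK, -, -, hB⟩ := exists_isQuad_of_mem_dartSides hiso d hp
  intro Y hY
  rw [← hK] at hY
  have h := convexHull_quad_subset_halfPlane hq.sum hY
  simp only [mem_setOf_eq] at h
  show 0 ≤ sideFn (emb.z p.1) (emb.c p.2) Y * sideFn (emb.z p.1) (emb.c p.2) (emb.dartCentre d)
  rw [sideFn_dartCentre hB]
  nlinarith

/-- **Half-discs at open side points**, for the sides of the rhombi of the tiling.
[cite: GrimmettManolescu2014Isoradial, §4.1 (rhombic tilings of the plane)] -/
theorem exists_ball_inter_sideInner_subset (hiso : emb.IsIsoradial) (d : G.Dart) {p : V × F}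
    (hp : p ∈ emb.dartSides d) {m : ℂ} (hm : m ∈ openSegment ℝ (emb.z p.1) (emb.c p.2)) :
    ∃ r > 0, ball m r ∩ emb.sideInner d p ⊆ emb.rhombus ⟨d.edge, d.edge_mem⟩ ∧
      ball m r ∩ {Y | 0 < sideFn (emb.z p.1) (emb.c p.2) Y *
        sideFn (emb.z p.1) (emb.c p.2) (emb.dartCentre d)} ⊆
        interior (emb.rhombus ⟨d.edge, d.edge_mem⟩) := by
  obtain ⟨B', Q', hq, hK, -, -, hB⟩ := exists_isQuad_of_mem_dartSides hiso d hp
  obtain ⟨r, hr, h1, h2⟩ := exists_ball_inter_halfPlane_subset_quad hq hm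
  rw [hK] at h1 h2
  have hc := sideFn_dartCentre (emb := emb) (d := d) (p := p) hB
  refine ⟨r, hr, ?_, ?_⟩
  · rintro Y ⟨hY, hYH⟩
    refine h1 ⟨hY, ?_⟩
    have hYH' : 0 ≤ sideFn (emb.z p.1) (emb.c p.2) Y *
        sideFn (emb.z p.1) (emb.c p.2) (emb.dartCentre d) := hYH
    rw [hc] at hYH'
    show 0 ≤ sideFn (emb.z p.1) (emb.c p.2) Y * sideFn (emb.z p.1) (emb.c p.2) B'
    nlinarith
  · rintro Y ⟨hY, hYH⟩
    refine h2 ⟨hY, ?_⟩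
    have hYH' : 0 < sideFn (emb.z p.1) (emb.c p.2) Y *
        sideFn (emb.z p.1) (emb.c p.2) (emb.dartCentre d) := hYH
    rw [hc] at hYH'
    show 0 < sideFn (emb.z p.1) (emb.c p.2) Y * sideFn (emb.z p.1) (emb.c p.2) B'
    nlinarith

/-- **No corner of a rhombus lies in one of its own open sides.** [folklore] -/
theorem corner_not_mem_openSegment_self (hiso : emb.IsIsoradial) (d : G.Dart) {p : V × F}
    (hp : p ∈ emb.dartSides d) {Z : ℂ}
    (hZ : Z = emb.z d.fst ∨ Z = emb.c (emb.leftFace d) ∨ Z = emb.z d.snd ∨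
      Z = emb.c (emb.rightFace d)) :
    Z ∉ openSegment ℝ (emb.z p.1) (emb.c p.2) := by
  obtain ⟨B', Q', hq, -, hB', hQ', -⟩ := exists_isQuad_of_mem_dartSides hiso d hp
  -- `Z` is one of the corners `z p.1, c p.2, B', Q'` of the re-labelled quadrilateral
  apply corner_not_mem_openSegment hq
  have hZv : Z = emb.z d.fst ∨ Z = emb.z d.snd → Z = emb.z p.1 ∨ Z = B' := by
    intro h
    have : Z ∈ ({emb.z d.fst, emb.z d.snd} : Set ℂ) := by
      rcases h with rfl | rfl <;> simp
    rw [← hB'] at this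
    simpa using this
  have hZf : Z = emb.c (emb.leftFace d) ∨ Z = emb.c (emb.rightFace d) → Z = emb.c p.2 ∨ Z = Q' := by
    intro h
    have : Z ∈ ({emb.c (emb.leftFace d), emb.c (emb.rightFace d)} : Set ℂ) := by
      rcases h with rfl | rfl <;> simp
    rw [← hQ'] at this
    simpa using this
  rcases hZ with h | h | h | h
  · rcases hZv (Or.inl h) with h' | h'
    · exact Or.inl h'
    · exact Or.inr (Or.inr (Or.inl h'))
  · rcases hZf (Or.inl h) with h' | h'
    · exact Or.inr (Or.inl h')
    · exact Or.inr (Or.inr (Or.inr h'))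
  · rcases hZv (Or.inr h) with h' | h'
    · exact Or.inl h'
    · exact Or.inr (Or.inr (Or.inl h'))
  · rcases hZf (Or.inr h) with h' | h'
    · exact Or.inr (Or.inl h')
    · exact Or.inr (Or.inr (Or.inr h'))

end Sides

/-! ### Local finiteness -/

section LocallyFinite

/-- The midpoint of the primal diagonal of the rhombus of `e`. [folklore] -/
def _root_.Literature.Probability.LatticeModels.RhombicEmbedding.mid
    (emb : RhombicEmbedding G F) (e : G.edgeSet) : ℂ :=
  (emb.z (RhombicEmbedding.refDart e).fst + emb.z (RhombicEmbedding.refDart e).snd) / 2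

/-- **A rhombus lies in the closed unit disc about its centre** (half-diagonals have length at
most `1`: `‖a‖² + ‖p‖² = 1`). [cite: GrimmettManolescu2014Isoradial, §2.1 (unit rhombi)] -/
theorem rhombus_subset_closedBall_mid (hiso : emb.IsIsoradial) (e : G.edgeSet) :
    emb.rhombus e ⊆ closedBall (emb.mid e) 1 := by
  set d := RhombicEmbedding.refDart e with hd
  obtain ⟨hsum, hAB, hPQ, hAP, hBP⟩ := dart_quad hiso d
  obtain ⟨hn, -⟩ := rhombus_halfDiag hsum hAP hBP
  have ha : ‖(emb.z d.fst - emb.z d.snd) / 2‖ ≤ 1 := by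
    have h1 : Complex.normSq ((emb.z d.fst - emb.z d.snd) / 2) ≤ 1 := by
      linarith [Complex.normSq_nonneg ((emb.c (emb.leftFace d) - emb.c (emb.rightFace d)) / 2)]
    rw [Complex.normSq_eq_norm_sq] at h1
    nlinarith [norm_nonneg ((emb.z d.fst - emb.z d.snd) / 2)]
  have hp : ‖(emb.c (emb.leftFace d) - emb.c (emb.rightFace d)) / 2‖ ≤ 1 := by
    have h1 : Complex.normSq ((emb.c (emb.leftFace d) - emb.c (emb.rightFace d)) / 2) ≤ 1 := by
      linarith [Complex.normSq_nonneg ((emb.z d.fst - emb.z d.snd) / 2)]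
    rw [Complex.normSq_eq_norm_sq] at h1
    nlinarith [norm_nonneg ((emb.c (emb.leftFace d) - emb.c (emb.rightFace d)) / 2)]
  have hM : emb.mid e = (emb.z d.fst + emb.z d.snd) / 2 := rfl
  unfold RhombicEmbedding.rhombus
  refine convexHull_min ?_ (convex_closedBall _ _)
  intro X hX
  simp only [mem_insert_iff, mem_singleton_iff] at hX
  rw [mem_closedBall, dist_eq_norm, hM]
  rcases hX with rfl | rfl | rfl | rfl
  · have : emb.z d.fst - (emb.z d.fst + emb.z d.snd) / 2 = (emb.z d.fst - emb.z d.snd) / 2 := by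
      ring
    rw [← hd, this]; exact ha
  · have : emb.c (emb.leftFace d) - (emb.z d.fst + emb.z d.snd) / 2 =
        (emb.c (emb.leftFace d) - emb.c (emb.rightFace d)) / 2 := by
      linear_combination (1 / 2 : ℂ) * hsum
    rw [← hd, this]; exact hp
  · have : emb.z d.snd - (emb.z d.fst + emb.z d.snd) / 2 = -((emb.z d.fst - emb.z d.snd) / 2) := by
      ring
    rw [← hd, this, norm_neg]; exact ha
  · have : emb.c (emb.rightFace d) - (emb.z d.fst + emb.z d.snd) / 2 =
        -((emb.c (emb.leftFace d) - emb.c (emb.rightFace d)) / 2) := by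
      linear_combination (1 / 2 : ℂ) * hsum
    rw [← hd, this, norm_neg]; exact hp

variable {ε : ℝ}

/-- **Finitely many edge midpoints in a box** (they are `sin² ε`-separated in the sup norm,
`le_boxNorm_mid_sub_mid`; injection into a finite grid — the argument of
`IsoradialCriticality.finite_setOf_boxNorm_le`, isolated).
[cite: GrimmettManolescu2014Isoradial, §4.4 Prop. 7 (equivalence of metrics; arXiv:1204.0505v2 numbering)] -/
theorem finite_setOf_mid_boxNorm_le (hiso : emb.IsIsoradial) (hrh : emb.IsRhombicTiling)
    (hbap : emb.HasBoundedAngles ε) (hε : 0 < ε) (w₀ : ℂ) (R : ℝ) :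
    {e : G.edgeSet | (emb.mid e - w₀).boxNorm ≤ R}.Finite := by
  classical
  set Ed : Set G.edgeSet := {e : G.edgeSet | (emb.mid e - w₀).boxNorm ≤ R} with hEd_def
  rcases Ed.eq_empty_or_nonempty with hempty | ⟨e₀, -⟩
  · rw [hempty]; exact Set.finite_empty
  have hsin : 0 < Real.sin ε := sin_pos_of_hasBoundedAngles hbap hε (RhombicEmbedding.refDart e₀)
  set ρ₀ := Real.sin ε * Real.sin ε with hρ₀
  have hρ : 0 < ρ₀ := mul_pos hsin hsin
  set N : ℤ := ⌈R / ρ₀⌉ + 1 with hN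
  set f : G.edgeSet → ℤ × ℤ := fun e =>
    (⌊(emb.mid e - w₀).re / ρ₀⌋, ⌊(emb.mid e - w₀).im / ρ₀⌋) with hf
  have hfl : ∀ t : ℝ, |t| ≤ R → -N ≤ ⌊t / ρ₀⌋ ∧ ⌊t / ρ₀⌋ ≤ N := by
    intro t ht
    have hab := abs_le.1 ht
    constructor
    · have h1 : -(R / ρ₀) ≤ t / ρ₀ := by
        rw [← neg_div]; exact div_le_div_of_nonneg_right hab.1 hρ.le
      have h2 := Int.floor_mono h1
      rw [Int.floor_neg] at h2
      omega
    · have h1 : t / ρ₀ ≤ R / ρ₀ := div_le_div_of_nonneg_right hab.2 hρ.le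
      have h2 := (Int.floor_mono h1).trans (Int.floor_le_ceil _)
      omega
  refine Set.Finite.of_finite_image (f := f) ?_ ?_
  · refine (Set.finite_Icc ((-N, -N) : ℤ × ℤ) (N, N)).subset ?_
    rintro _ ⟨e, he, rfl⟩
    have hb : (emb.mid e - w₀).boxNorm ≤ R := he
    obtain ⟨h1, h2⟩ := hfl _ ((abs_re_le_boxNorm _).trans hb)
    obtain ⟨h3, h4⟩ := hfl _ ((abs_im_le_boxNorm _).trans hb)
    exact ⟨⟨h1, h3⟩, ⟨h2, h4⟩⟩
  · intro e _ e' _ heq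
    by_contra hne
    have hsep : ρ₀ ≤ (emb.mid e - emb.mid e').boxNorm := le_boxNorm_mid_sub_mid hiso hrh hbap hε hne
    simp only [hf, Prod.mk.injEq] at heq
    have hre := Int.abs_sub_lt_one_of_floor_eq_floor heq.1
    have him := Int.abs_sub_lt_one_of_floor_eq_floor heq.2
    rw [← sub_div, abs_div, abs_of_pos hρ, div_lt_one hρ] at hre him
    have : (emb.mid e - emb.mid e').boxNorm < ρ₀ := by
      unfold Complex.boxNorm
      rw [Complex.sub_re, Complex.sub_im]
      refine max_lt ?_ ?_
      · have : (emb.mid e).re - (emb.mid e').re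
            = (emb.mid e - w₀).re - (emb.mid e' - w₀).re := by simp
        rw [this]; exact hre
      · have : (emb.mid e).im - (emb.mid e').im
            = (emb.mid e - w₀).im - (emb.mid e' - w₀).im := by simp
        rw [this]; exact him
    linarith

/-- **Local finiteness of the tiling**: only finitely many rhombi meet a given disc.
[cite: GrimmettManolescu2014Isoradial, §4.1 (rhombic tilings) and §4.4 Prop. 7] -/
theorem finite_setOf_rhombus_inter_closedBall (hiso : emb.IsIsoradial) (hrh : emb.IsRhombicTiling)
    (hbap : emb.HasBoundedAngles ε) (hε : 0 < ε) (w : ℂ) (R : ℝ) :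
    {e : G.edgeSet | (emb.rhombus e ∩ closedBall w R).Nonempty}.Finite := by
  refine (finite_setOf_mid_boxNorm_le hiso hrh hbap hε w (R + 1)).subset ?_
  rintro e ⟨X, hXe, hXw⟩
  have h1 : ‖X - emb.mid e‖ ≤ 1 := by
    have := rhombus_subset_closedBall_mid hiso e hXe
    rwa [mem_closedBall, dist_eq_norm] at this
  rw [mem_closedBall, dist_eq_norm] at hXw
  show (emb.mid e - w).boxNorm ≤ R + 1
  refine (boxNorm_le_norm _).trans ?_
  have : emb.mid e - w = (X - w) - (X - emb.mid e) := by ring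
  rw [this]
  exact (norm_sub_le _ _).trans (by linarith)

/-- **Pigeonhole.** If `x k → m` and each `x k` lies in the rhombus of `e k`, then some single
rhombus contains `m` and contains `x k` for infinitely many `k`. [folklore] -/
theorem exists_rhombus_mem_of_tendsto (hiso : emb.IsIsoradial) (hrh : emb.IsRhombicTiling)
    (hbap : emb.HasBoundedAngles ε) (hε : 0 < ε) {x : ℕ → ℂ} {m : ℂ}
    (hx : Tendsto x atTop (𝓝 m)) (e : ℕ → G.edgeSet) (he : ∀ k, x k ∈ emb.rhombus (e k)) :
    ∃ e₀ : G.edgeSet, m ∈ emb.rhombus e₀ ∧ {k | e k = e₀}.Infinite := by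
  -- eventually `x k ∈ closedBall m 1`
  have hev : ∀ᶠ k in atTop, x k ∈ closedBall m 1 :=
    hx (Metric.closedBall_mem_nhds m zero_lt_one)
  obtain ⟨K, hK⟩ := eventually_atTop.1 hev
  set S : Set G.edgeSet := {e' | (emb.rhombus e' ∩ closedBall m 1).Nonempty} with hS
  have hSfin : S.Finite := finite_setOf_rhombus_inter_closedBall hiso hrh hbap hε m 1
  have hmemS : ∀ k, e (k + K) ∈ S := fun k =>
    ⟨x (k + K), he (k + K), hK _ (Nat.le_add_left K k)⟩
  -- an infinite fibre of `k ↦ e (k + K)` in the finite set `S`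
  haveI : Finite S := hSfin.to_subtype
  obtain ⟨⟨e₀, he₀S⟩, hinf⟩ := Finite.exists_infinite_fiber (fun k : ℕ => (⟨e (k + K), hmemS k⟩ : S))
  have hinf' : {k | e (k + K) = e₀}.Infinite := by
    have : {k | e (k + K) = e₀} = (fun k : ℕ => (⟨e (k + K), hmemS k⟩ : S)) ⁻¹' {⟨e₀, he₀S⟩} := by
      ext k; simp [Subtype.ext_iff]
    rw [this]; exact Set.infinite_coe_iff.1 hinf
  have hinf'' : {k | e k = e₀}.Infinite := by
    have hsub : (fun k => k + K) '' {k | e (k + K) = e₀} ⊆ {k | e k = e₀} := by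
      rintro _ ⟨k, hk, rfl⟩; exact hk
    exact (hinf'.image (fun a _ b _ h => Nat.add_right_cancel h)).mono hsub
  refine ⟨e₀, ?_, hinf''⟩
  -- `m ∈ rhombus e₀` by closedness
  by_contra hm
  have hopen : IsOpen (emb.rhombus e₀)ᶜ := by
    unfold RhombicEmbedding.rhombus
    exact (isClosed_quad _ _ _ _).isOpen_compl
  obtain ⟨r, hr, hrsub⟩ := Metric.isOpen_iff.1 hopen m hm
  have hev' : ∀ᶠ k in atTop, x k ∈ ball m r := hx (Metric.ball_mem_nhds m hr)
  obtain ⟨K', hK'⟩ := eventually_atTop.1 hev'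
  obtain ⟨k, hk, hkK'⟩ := hinf''.exists_gt K'
  have h1 : x k ∈ emb.rhombus e₀ := hk ▸ he k
  exact hrsub (hK' k hkK'.le) h1

end LocallyFinite

/-! ### The rhombus across a side -/

section Across

variable [DecidableEq V] [DecidableEq F] {ε : ℝ}

/-- **The rhombus across a side.** Every point of an open side of the rhombus of `d` lies in the
rhombus of some other edge (the points just outside that side are covered by other rhombi, of
which only finitely many come near; one of them contains points converging to the given one).
[cite: GrimmettManolescu2014Isoradial, §4.1 (the diamond graph is a rhombic tiling of the plane)] -/
theorem exists_rhombus_across_side (hiso : emb.IsIsoradial) (hrh : emb.IsRhombicTiling)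
    (hbap : emb.HasBoundedAngles ε) (hε : 0 < ε) (d : G.Dart) {p : V × F}
    (hp : p ∈ emb.dartSides d) {m : ℂ} (hm : m ∈ openSegment ℝ (emb.z p.1) (emb.c p.2)) :
    ∃ d' : G.Dart, d'.edge ≠ d.edge ∧ m ∈ emb.rhombus ⟨d'.edge, d'.edge_mem⟩ := by
  set A' := emb.z p.1 with hA'
  set P' := emb.c p.2 with hP'
  set σ := sideFn A' P' (emb.dartCentre d) with hσ
  have hσ0 : σ ≠ 0 := sideFn_dartCentre_ne_zero hiso d hp
  have hm0 : sideFn A' P' m = 0 := by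
    rw [openSegment_eq_image] at hm
    obtain ⟨θ, -, rfl⟩ := hm
    rw [sideFn_combo A' P' A' P' (by ring : (1 - θ) + θ = 1)]; simp
  -- the outward normal direction `w = I (P' - A')`: `sideFn A' P' (m + t w) = t`
  set w : ℂ := I * (P' - A') with hw
  have hw1 : (w * conj (P' - A')).im = 1 := by
    have hn : ‖P' - A'‖ = 1 := by rw [norm_sub_rev]; exact norm_side_eq_one hiso d hp
    rw [hw, mul_assoc, Complex.mul_conj, Complex.normSq_eq_norm_sq, hn]
    simp
  set x : ℕ → ℂ := fun k => m + ((-σ / (k + 1) : ℝ) : ℂ) * w with hx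
  have hxside : ∀ k, sideFn A' P' (x k) = -σ / (k + 1) := fun k => by
    simp only [hx]; rw [sideFn_add_smul, hm0, hw1]; ring
  -- `x k` is not in the rhombus of `d`
  have hxnot : ∀ k, x k ∉ emb.rhombus ⟨d.edge, d.edge_mem⟩ := by
    intro k hk
    have h := rhombus_subset_sideInner hiso d hp hk
    change 0 ≤ sideFn A' P' (x k) * σ at h
    rw [hxside] at h
    have hk1 : (0 : ℝ) < k + 1 := by positivity
    have : -σ / (k + 1) * σ = -(σ * σ) / (k + 1) := by ring
    rw [this] at h
    have hσ2 : 0 < σ * σ := mul_self_pos.2 hσ0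
    have : -(σ * σ) / (k + 1) < 0 := div_neg_of_neg_of_pos (by linarith) hk1
    linarith
  -- each `x k` is covered by some rhombus
  have hcov : ∀ k, ∃ e : G.edgeSet, x k ∈ emb.rhombus e := fun k => by
    have : x k ∈ ⋃ e : G.edgeSet, emb.rhombus e := by rw [hrh.iUnion_rhombus]; trivial
    exact mem_iUnion.1 this
  choose e he using hcov
  -- `x k → m`
  have hxt : Tendsto x atTop (𝓝 m) := by
    have h1 : Tendsto (fun k : ℕ => (-σ / ((k : ℝ) + 1) : ℝ)) atTop (𝓝 0) := by
      have := tendsto_one_div_add_atTop_nhds_zero_nat (𝕜 := ℝ)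
      have h2 := this.const_mul (-σ)
      rw [mul_zero] at h2
      refine h2.congr (fun k => ?_)
      ring
    have h2 : Tendsto (fun k : ℕ => m + ((-σ / ((k : ℝ) + 1) : ℝ) : ℂ) * w) atTop (𝓝 (m + (0 : ℂ) * w)) :=
      tendsto_const_nhds.add ((Complex.continuous_ofReal.continuousAt.tendsto.comp h1).mul
        tendsto_const_nhds)
    rw [zero_mul, add_zero] at h2
    exact h2
  obtain ⟨e₀, hme₀, hinf⟩ := exists_rhombus_mem_of_tendsto hiso hrh hbap hε hxt e he
  obtain ⟨k, hk⟩ := hinf.nonempty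
  refine ⟨RhombicEmbedding.refDart e₀, ?_, ?_⟩
  · intro heq
    apply hxnot k
    have h1 : x k ∈ emb.rhombus e₀ := hk ▸ he k
    have h2 : e₀ = ⟨d.edge, d.edge_mem⟩ := by
      apply Subtype.ext
      show (e₀ : Sym2 V) = d.edge
      rw [← heq]
      exact (RhombicEmbedding.refDart_edge e₀).symm
    rwa [h2] at h1
  · have h2 : (⟨(RhombicEmbedding.refDart e₀).edge, (RhombicEmbedding.refDart e₀).edge_mem⟩ :
        G.edgeSet) = e₀ := Subtype.ext (RhombicEmbedding.refDart_edge e₀)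
    rw [h2]; exact hme₀

/-- **Across a side.** If the rhombus of another edge contains a point of the open side
`(z v, c f)`, `(v, f) ∈ dartSides d`, of the rhombus of `d`, then it lies in the closed outer
half-plane of that side. [cite: GrimmettManolescu2014Isoradial, §4.1 (the diamond graph is a rhombic tiling of the plane)] -/
theorem rhombus_subset_sideOuter (hiso : emb.IsIsoradial) (hrh : emb.IsRhombicTiling)
    (d d' : G.Dart) (hne : d'.edge ≠ d.edge) {p : V × F} (hp : p ∈ emb.dartSides d) {m : ℂ}
    (hm : m ∈ openSegment ℝ (emb.z p.1) (emb.c p.2))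
    (hm' : m ∈ emb.rhombus ⟨d'.edge, d'.edge_mem⟩) :
    emb.rhombus ⟨d'.edge, d'.edge_mem⟩ ⊆ emb.sideOuter d p := by
  obtain ⟨B', Q', hq, hK, -, -, hB⟩ := exists_isQuad_of_mem_dartSides hiso d hp
  have hq' := dart_isQuad hiso d'
  have hne' : (⟨d.edge, d.edge_mem⟩ : G.edgeSet) ≠ ⟨d'.edge, d'.edge_mem⟩ :=
    fun h => hne (congrArg Subtype.val h).symm
  have hdisj : Disjoint (interior (emb.rhombus ⟨d.edge, d.edge_mem⟩))
      (interior (emb.rhombus ⟨d'.edge, d'.edge_mem⟩)) := hrh.disjoint_interior hne'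
  rw [← hK, rhombus_dart_eq hiso d'] at hdisj
  rw [rhombus_dart_eq hiso d'] at hm' ⊢
  have h := subset_outer_of_mem_openSegment hq (convex_convexHull ℝ _)
    (subset_closure_interior_quad hq') hdisj hm hm'
  intro Y hY
  have h1 := h hY
  simp only [mem_setOf_eq] at h1
  show sideFn (emb.z p.1) (emb.c p.2) Y * sideFn (emb.z p.1) (emb.c p.2) (emb.dartCentre d) ≤ 0
  rw [sideFn_dartCentre hB]
  nlinarith

/-- **A rhombus with a corner in an open side of another lies across that side**: if a corner
`Z` of the rhombus of `d'` lies in the open side `(z v, c f)` of the rhombus of `d`, then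
`d'.edge ≠ d.edge` and the rhombus of `d'` lies in the outer half-plane of that side.
[cite: GrimmettManolescu2014Isoradial, §4.1 (the diamond graph is a rhombic tiling of the plane)] -/
theorem rhombus_subset_sideOuter_of_corner (hiso : emb.IsIsoradial) (hrh : emb.IsRhombicTiling)
    (d d' : G.Dart) {p : V × F} (hp : p ∈ emb.dartSides d) {Z : ℂ}
    (hZ : Z = emb.z d'.fst ∨ Z = emb.c (emb.leftFace d') ∨ Z = emb.z d'.snd ∨
      Z = emb.c (emb.rightFace d'))
    (hZm : Z ∈ openSegment ℝ (emb.z p.1) (emb.c p.2)) :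
    d'.edge ≠ d.edge ∧ emb.rhombus ⟨d'.edge, d'.edge_mem⟩ ⊆ emb.sideOuter d p := by
  have hne : d'.edge ≠ d.edge := by
    intro heq
    -- then `Z` would be a corner of the rhombus of `d` in its own open side
    have hZ' : Z = emb.z d.fst ∨ Z = emb.c (emb.leftFace d) ∨ Z = emb.z d.snd ∨
        Z = emb.c (emb.rightFace d) := by
      rcases (SimpleGraph.dart_edge_eq_iff d' d).1 heq with rfl | rfl
      · exact hZ
      · rw [hiso.leftFace_symm] at hZ
        have hr : emb.rightFace d.symm = emb.leftFace d := by
          rw [← hiso.leftFace_symm d.symm, SimpleGraph.Dart.symm_symm]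
        rw [hr] at hZ
        simp only [SimpleGraph.Dart.symm_toProd, Prod.fst_swap, Prod.snd_swap] at hZ
        tauto
    exact corner_not_mem_openSegment_self hiso d hp hZ' hZm
  refine ⟨hne, rhombus_subset_sideOuter hiso hrh d d' hne hp hZm ?_⟩
  rw [rhombus_dart_eq hiso d']
  obtain ⟨hA, hP, hB, hQ⟩ := corners_mem_convexHull_quad (emb.z d'.fst) (emb.c (emb.leftFace d'))
    (emb.z d'.snd) (emb.c (emb.rightFace d'))
  rcases hZ with rfl | rfl | rfl | rfl <;> assumption

end Across

end Literature.Probability.Percolation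

end

/-!
# Planarity of rhombic tilings, IV: no T-junctions (the fault-line argument)

Topic `Literature/Probability/Percolation`; theorems only. Let `emb : RhombicEmbedding G F` be
isoradial with the tiling condition `IsRhombicTiling` and bounded angles BAP(ε), `ε > 0`, and let
`G` be preconnected. **Then the rhombic tiling is edge-to-edge: no corner of a rhombus lies in
an open side of a rhombus** (`corner_not_mem_openSegment_side`). Grimmett–Manolescu
(PTRF 159 (2014) = arXiv:1204.0505, §4.1) *define* a rhombic tiling as "a planar graph embedded
in `ℝ²` such that every face is a rhombus", so that this is part of the definition; the tree's
`IsRhombicTiling` only records that the unit rhombi of the edges have pairwise disjoint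
interiors and cover the plane (and that `c` is injective), and the present file derives the
combinatorial statement from it. Connectedness of `G` is essential: the rows of a tiling by unit
squares may be shifted against each other (a "fault line"), the primal graph then falling into
the pieces above and below the line.

The proof is the classical fault-line argument. Suppose a corner `P₀` of some rhombus lies in
the open side `σ ⊆ ℓ` of the rhombus `T ⊆ H⁺` (closed half-plane of `ℓ`).
* `faultStep`: then some rhombus `T₁ ⊆ H⁻` has `P₀` as a corner and a side `[P₀, P₀ ± u]` on `ℓ`
  (`u` the unit vector of `ℓ`): the points `P₀ + δ u ∈ σ`, `δ ↓ 0`, are covered by rhombi other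
  than `T`, all in `H⁻` (across a side), finitely many near `P₀`; one of them, `T₁`, contains
  `P₀` and some `P₀ + δ u`, hence (faces in a supporting line) meets `ℓ` in a side `[C, C']`
  containing both; `P₀` cannot be interior to that side (the rhombus with corner `P₀` would lie
  in `H⁺ ∩ H⁻ = ℓ`), so `{C, C'} = {P₀, P₀ + u}`.
* `fault_forward`, `fault_all`: iterating, the sides of `H⁺`-rhombi on `ℓ` are exactly the
  segments `[X + n u, X + (n+1) u]`, `n ∈ ℤ`, and those of `H⁻`-rhombi the segments
  `[Y + n u, Y + (n+1) u]`, with `X - Y = λ u`, `0 < λ < 1` — a fault line.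
* `false_of_fault`: along a fault line no rhombus has an interior point on `ℓ`, every rhombus
  lies in `H⁺` or in `H⁻`, a corner on `ℓ` of an `H⁺`-rhombus lies in `X + ℤ u` and of an
  `H⁻`-rhombus in `Y + ℤ u` — disjoint sets —, so every vertex of `G` has all its rhombi on one
  side, adjacent vertices are on the same side, and both sides occur: `G` is disconnected.

## References

* G. R. Grimmett, I. Manolescu, *Bond percolation on isoradial graphs*, PTRF 159 (2014),
  arXiv:1204.0505, §4.1 (rhombic tilings; track systems).
* R. Kenyon, J.-M. Schlenker, *Rhombic embeddings of planar quad-graphs*, TAMS 357 (2005), §3.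
* N. G. de Bruijn, *Algebraic theory of Penrose's non-periodic tilings*, Indag. Math. 43 (1981), §4.
* B. Grünbaum, G. C. Shephard, *Tilings and Patterns* (1987), §1.1–1.2 (edge-to-edge tilings).
-/

noncomputable section

open Complex ComplexConjugate Metric Set Filter Topology

namespace Literature.Probability.Percolation

open Literature.Probability.LatticeModels IsoradialCriticality

variable {V F : Type*} {G : SimpleGraph V} {emb : RhombicEmbedding G F}
variable [DecidableEq V] [DecidableEq F] {ε : ℝ}

namespace FaultLine

/-! ### Bookkeeping: corners, sides, segments on a line -/

/-- The endpoints of a side of the rhombus of `d` are corners of it. [folklore] -/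
theorem corner_of_mem_dartSides {d : G.Dart} {p : V × F} (hp : p ∈ emb.dartSides d) {Z : ℂ}
    (hZ : Z = emb.z p.1 ∨ Z = emb.c p.2) :
    Z = emb.z d.fst ∨ Z = emb.c (emb.leftFace d) ∨ Z = emb.z d.snd ∨
      Z = emb.c (emb.rightFace d) := by
  rcases (mem_dartSides_iff d p).1 hp with rfl | rfl | rfl | rfl <;>
    rcases hZ with rfl | rfl <;> simp

/-- A side is contained in its rhombus. [folklore] -/
theorem segment_side_subset_rhombus (hiso : emb.IsIsoradial) {d : G.Dart} {p : V × F}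
    (hp : p ∈ emb.dartSides d) :
    segment ℝ (emb.z p.1) (emb.c p.2) ⊆ emb.rhombus ⟨d.edge, d.edge_mem⟩ := by
  rw [rhombus_dart_eq hiso d]
  obtain ⟨hA, hP, hB, hQ⟩ := corners_mem_convexHull_quad (emb.z d.fst) (emb.c (emb.leftFace d))
    (emb.z d.snd) (emb.c (emb.rightFace d))
  apply (convex_convexHull ℝ _).segment_subset
  · rcases corner_of_mem_dartSides hp (Or.inl rfl) with h | h | h | h <;> rw [h] <;> assumption
  · rcases corner_of_mem_dartSides hp (Or.inr rfl) with h | h | h | h <;> rw [h] <;> assumption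

/-- Two unordered pairs with the same set have the same segment. [folklore] -/
theorem segment_eq_of_pair_eq {a b X X' : ℂ} (h : ({a, b} : Set ℂ) = {X, X'}) :
    segment ℝ a b = segment ℝ X X' := by
  rcases Set.pair_eq_pair_iff.1 h with ⟨rfl, rfl⟩ | ⟨rfl, rfl⟩
  · rfl
  · exact segment_symm ℝ _ _

/-- Two unordered pairs with the same set have the same open segment. [folklore] -/
theorem openSegment_eq_of_pair_eq {a b X X' : ℂ} (h : ({a, b} : Set ℂ) = {X, X'}) :
    openSegment ℝ a b = openSegment ℝ X X' := by
  rcases Set.pair_eq_pair_iff.1 h with ⟨rfl, rfl⟩ | ⟨rfl, rfl⟩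
  · rfl
  · exact openSegment_symm ℝ _ _

/-- The point `X + λ u`, `0 < λ < 1`, lies in the open segment `(X, X + u)`. [folklore] -/
theorem add_mul_mem_openSegment (X u : ℂ) {t : ℝ} (h0 : 0 < t) (h1 : t < 1) :
    X + (t : ℂ) * u ∈ openSegment ℝ X (X + u) := by
  rw [openSegment_eq_image]
  exact ⟨t, ⟨h0, h1⟩, by simp only [Complex.real_smul]; push_cast; ring⟩

/-- Points of the open segment `(X, X + u)` are the `X + λ u`, `0 < λ < 1`. [folklore] -/
theorem exists_of_mem_openSegment {X u P : ℂ} (h : P ∈ openSegment ℝ X (X + u)) :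
    ∃ t : ℝ, 0 < t ∧ t < 1 ∧ P = X + (t : ℂ) * u := by
  rw [openSegment_eq_image] at h
  obtain ⟨t, ⟨h0, h1⟩, rfl⟩ := h
  exact ⟨t, h0, h1, by simp only [Complex.real_smul]; push_cast; ring⟩

/-- **Unit steps along a line.** If `m = P₀ + δ u` (`δ > 0`, `‖u‖ = 1`) lies on the segment
`[P₀, C]` with `‖C - P₀‖ = 1`, then `C = P₀ + u`. [folklore] -/
theorem eq_add_of_mem_segment {P₀ C u : ℂ} {δ : ℝ} (hδ : 0 < δ) (hu : ‖u‖ = 1)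
    (hC : ‖C - P₀‖ = 1) (hm : P₀ + (δ : ℂ) * u ∈ segment ℝ P₀ C) : C = P₀ + u := by
  rw [segment_eq_image] at hm
  obtain ⟨t, ⟨ht0, ht1⟩, ht⟩ := hm
  have key : (t : ℂ) * (C - P₀) = (δ : ℂ) * u := by
    have := ht
    simp only [Complex.real_smul] at this
    push_cast at this
    linear_combination this
  have htδ : t = δ := by
    have h := congrArg norm key
    rw [norm_mul, norm_mul, Complex.norm_real, Complex.norm_real, hC, hu, mul_one, mul_one,
      Real.norm_eq_abs, Real.norm_eq_abs, abs_of_nonneg ht0, abs_of_pos hδ] at h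
    exact h
  rw [htδ] at key
  have hδ0 : (δ : ℂ) ≠ 0 := by exact_mod_cast hδ.ne'
  have := mul_left_cancel₀ hδ0 key
  linear_combination this

/-! ### The line `ℓ = S₀S₁`, its half-planes `H(s) = {0 ≤ s · g}` and the sides on it -/

section Line

variable {S₀ S₁ u : ℂ}

/-- Translating along the line does not change the side functional. [folklore] -/
theorem sideFn_add_real_mul (hgu : (u * conj (S₁ - S₀)).im = 0) (Y : ℂ) (t : ℝ) :
    sideFn S₀ S₁ (Y + (t : ℂ) * u) = sideFn S₀ S₁ Y := by
  rw [sideFn_add_smul, hgu, mul_zero, add_zero]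

/-- **Conversion between the half-planes of a side on `ℓ` and the half-planes of `ℓ`.** If the
rhombus of `d` lies in `H(s)` and its side `p` lies on `ℓ`, then `H(s)` is the inner half-plane
of that side, `{0 < s g}` its strict inner half-plane, and the outer half-plane is `H(-s)`.
[folklore] -/
theorem halfPlane_conv (hiso : emb.IsIsoradial) (hS : S₀ ≠ S₁) {s : ℝ} (hs : s ≠ 0)
    {d : G.Dart} (hT : emb.rhombus ⟨d.edge, d.edge_mem⟩ ⊆ {Y | 0 ≤ s * sideFn S₀ S₁ Y})
    {p : V × F} (hp : p ∈ emb.dartSides d) (hp1 : sideFn S₀ S₁ (emb.z p.1) = 0)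
    (hp2 : sideFn S₀ S₁ (emb.c p.2) = 0) :
    {Y | 0 ≤ s * sideFn S₀ S₁ Y} ⊆ emb.sideInner d p ∧
      {Y | 0 < s * sideFn S₀ S₁ Y} ⊆ {Y | 0 < sideFn (emb.z p.1) (emb.c p.2) Y *
        sideFn (emb.z p.1) (emb.c p.2) (emb.dartCentre d)} ∧
      emb.sideOuter d p ⊆ {Y | 0 ≤ -s * sideFn S₀ S₁ Y} := by
  obtain ⟨κ, hκ, hf⟩ := exists_sideFn_eq_mul hS hp1 hp2 (z_ne_c_of_mem_dartSides hiso d hp)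
  set g := fun Y => sideFn S₀ S₁ Y with hg
  set M := emb.dartCentre d with hM
  have hfM : sideFn (emb.z p.1) (emb.c p.2) M ≠ 0 := sideFn_dartCentre_ne_zero hiso d hp
  have hgM : g M ≠ 0 := by
    intro h0; apply hfM; rw [hf M]; simp only [hg] at h0; rw [h0, mul_zero]
  -- `M ∈ rhombus d`, so `0 ≤ s g M`, hence `0 < s g M`
  have hMin : M ∈ emb.rhombus ⟨d.edge, d.edge_mem⟩ := by
    rw [rhombus_dart_eq hiso d]
    exact interior_subset (centre_mem_interior_quad (dart_isQuad hiso d))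
  have hsM : 0 < s * g M := by
    have h1 : 0 ≤ s * g M := hT hMin
    rcases h1.eq_or_lt with h | h
    · exfalso
      rcases mul_eq_zero.1 h.symm with h' | h'
      · exact hs h'
      · exact hgM h'
    · exact h
  have hκ2 : 0 < κ * κ := mul_self_pos.2 hκ
  refine ⟨?_, ?_, ?_⟩
  · intro Y hY
    have hY' : 0 ≤ s * g Y := hY
    show 0 ≤ sideFn (emb.z p.1) (emb.c p.2) Y * sideFn (emb.z p.1) (emb.c p.2) M
    rw [hf Y, hf M]
    have : κ * g Y * (κ * g M) = (κ * κ) * ((s * g Y) * (s * g M)) / (s * s) := by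
      field_simp
    rw [this]
    apply div_nonneg _ (mul_self_nonneg s)
    exact mul_nonneg hκ2.le (mul_nonneg hY' hsM.le)
  · intro Y hY
    have hY' : 0 < s * g Y := hY
    show 0 < sideFn (emb.z p.1) (emb.c p.2) Y * sideFn (emb.z p.1) (emb.c p.2) M
    rw [hf Y, hf M]
    have : κ * g Y * (κ * g M) = (κ * κ) * ((s * g Y) * (s * g M)) / (s * s) := by
      field_simp
    rw [this]
    apply div_pos _ (mul_self_pos.2 hs)
    exact mul_pos hκ2 (mul_pos hY' hsM)
  · intro Y hY
    have hY' : sideFn (emb.z p.1) (emb.c p.2) Y * sideFn (emb.z p.1) (emb.c p.2) M ≤ 0 := hY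
    rw [hf Y, hf M] at hY'
    show 0 ≤ -s * g Y
    have h1 : (s * g Y) * (s * g M) = (s * s) * (κ * g Y * (κ * g M)) / (κ * κ) := by
      field_simp
    have h2 : (s * g Y) * (s * g M) ≤ 0 := by
      rw [h1]
      apply div_nonpos_of_nonpos_of_nonneg _ hκ2.le
      exact mul_nonpos_of_nonneg_of_nonpos (mul_self_nonneg s) hY'
    have h3 : s * g Y ≤ 0 := by
      by_contra hcon
      push Not at hcon
      have := mul_pos hcon hsM
      linarith
    linarith

/-- The rhombus of `d` lies in the half-plane `H(s)`, `s = g (dartCentre d)`, of each of its own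
sides. [folklore] -/
theorem rhombus_subset_halfPlane_self (hiso : emb.IsIsoradial) {d : G.Dart} {p : V × F}
    (hp : p ∈ emb.dartSides d) :
    emb.rhombus ⟨d.edge, d.edge_mem⟩ ⊆
      {Y | 0 ≤ sideFn (emb.z p.1) (emb.c p.2) (emb.dartCentre d) * sideFn (emb.z p.1) (emb.c p.2) Y} := by
  intro Y hY
  have h := rhombus_subset_sideInner hiso d hp hY
  show 0 ≤ sideFn (emb.z p.1) (emb.c p.2) (emb.dartCentre d) * sideFn (emb.z p.1) (emb.c p.2) Y
  rw [mul_comm]; exact h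

omit [DecidableEq V] [DecidableEq F] in
/-- A rhombus contained in `H(s) ∩ H(-s)` would lie in the line: impossible. [folklore] -/
theorem false_of_subset_both (hiso : emb.IsIsoradial) (hS : S₀ ≠ S₁) {s : ℝ} (hs : s ≠ 0)
    {d : G.Dart} (h1 : emb.rhombus ⟨d.edge, d.edge_mem⟩ ⊆ {Y | 0 ≤ s * sideFn S₀ S₁ Y})
    (h2 : emb.rhombus ⟨d.edge, d.edge_mem⟩ ⊆ {Y | 0 ≤ -s * sideFn S₀ S₁ Y}) : False := by
  apply not_subset_line (dart_isQuad hiso d) hS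
  rw [← rhombus_dart_eq hiso d]
  intro Y hY
  have a : 0 ≤ s * sideFn S₀ S₁ Y := h1 hY
  have b : 0 ≤ -s * sideFn S₀ S₁ Y := h2 hY
  have : s * sideFn S₀ S₁ Y = 0 := by linarith
  rcases mul_eq_zero.1 this with h | h
  · exact absurd h hs
  · exact h

/-! ### The fault step -/

/-- **The fault step.** Let the rhombus `T` of `d` lie in `H(s)` with its side `p` equal to
`[X, X + u]` on `ℓ` (`u` a unit vector of `ℓ`), and let a corner `P₀` of some rhombus lie in the
open side `(X, X + u)`. Then there is a rhombus in `H(-s)` having `[P₀, P₀ + u]` as a side.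
[cite: GrimmettManolescu2014Isoradial, §4.1 (the diamond graph is a rhombic tiling of the plane)] -/
theorem faultStep (hiso : emb.IsIsoradial) (hrh : emb.IsRhombicTiling)
    (hbap : emb.HasBoundedAngles ε) (hε : 0 < ε) (hS : S₀ ≠ S₁) (hu : ‖u‖ = 1)
    (hgu : (u * conj (S₁ - S₀)).im = 0) {s : ℝ} (hs : s ≠ 0)
    {d : G.Dart} (hT : emb.rhombus ⟨d.edge, d.edge_mem⟩ ⊆ {Y | 0 ≤ s * sideFn S₀ S₁ Y})
    {p : V × F} (hp : p ∈ emb.dartSides d) {X : ℂ} (hX : sideFn S₀ S₁ X = 0)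
    (hside : ({emb.z p.1, emb.c p.2} : Set ℂ) = {X, X + u})
    {P₀ : ℂ} (hP₀ : P₀ ∈ openSegment ℝ X (X + u)) {d' : G.Dart}
    (hZ : P₀ = emb.z d'.fst ∨ P₀ = emb.c (emb.leftFace d') ∨ P₀ = emb.z d'.snd ∨
      P₀ = emb.c (emb.rightFace d')) :
    ∃ d₁ : G.Dart, emb.rhombus ⟨d₁.edge, d₁.edge_mem⟩ ⊆ {Y | 0 ≤ -s * sideFn S₀ S₁ Y} ∧
      ∃ p₁ ∈ emb.dartSides d₁, ({emb.z p₁.1, emb.c p₁.2} : Set ℂ) = {P₀, P₀ + u} := by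
  set g := fun Y => sideFn S₀ S₁ Y with hg
  have hXu : sideFn S₀ S₁ (X + u) = 0 := by
    have := sideFn_add_real_mul hgu X 1; push_cast at this; rw [one_mul] at this; rw [this, hX]
  -- the endpoints of the side `p` are on `ℓ`
  have hp1 : sideFn S₀ S₁ (emb.z p.1) = 0 := by
    have : emb.z p.1 ∈ ({X, X + u} : Set ℂ) := by rw [← hside]; simp
    rcases this with h | h
    · rw [h, hX]
    · rw [mem_singleton_iff] at h; rw [h, hXu]
  have hp2 : sideFn S₀ S₁ (emb.c p.2) = 0 := by
    have : emb.c p.2 ∈ ({X, X + u} : Set ℂ) := by rw [← hside]; simp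
    rcases this with h | h
    · rw [h, hX]
    · rw [mem_singleton_iff] at h; rw [h, hXu]
  obtain ⟨hconv1, -, hconv3⟩ := halfPlane_conv hiso hS hs hT hp hp1 hp2
  have hopen : openSegment ℝ (emb.z p.1) (emb.c p.2) = openSegment ℝ X (X + u) :=
    openSegment_eq_of_pair_eq hside
  -- `P₀ = X + λ u`
  obtain ⟨lam, hlam0, hlam1, hP₀eq⟩ := exists_of_mem_openSegment hP₀
  have hgP₀ : sideFn S₀ S₁ P₀ = 0 := by rw [hP₀eq, sideFn_add_real_mul hgu, hX]
  -- the points `m j = P₀ + δ j • u`, `δ j = (1 - λ)/(j+2)`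
  set δ : ℕ → ℝ := fun j => (1 - lam) / (j + 2) with hδ
  have hδpos : ∀ j, 0 < δ j := fun j => by simp only [hδ]; positivity
  have hδlt : ∀ j, lam + δ j < 1 := fun j => by
    simp only [hδ]
    have h2 : (2 : ℝ) ≤ (j : ℝ) + 2 := by linarith [(Nat.cast_nonneg j : (0 : ℝ) ≤ j)]
    have : (1 - lam) / ((j : ℝ) + 2) ≤ (1 - lam) / 2 :=
      div_le_div_of_nonneg_left (by linarith) (by norm_num) h2
    linarith
  set m : ℕ → ℂ := fun j => P₀ + ((δ j : ℝ) : ℂ) * u with hm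
  have hm_open : ∀ j, m j ∈ openSegment ℝ (emb.z p.1) (emb.c p.2) := fun j => by
    rw [hopen]
    have : m j = X + ((lam + δ j : ℝ) : ℂ) * u := by
      simp only [hm, hP₀eq]; push_cast; ring
    rw [this]
    exact add_mul_mem_openSegment X u (by linarith [hδpos j]) (hδlt j)
  have hgm : ∀ j, sideFn S₀ S₁ (m j) = 0 := fun j => by
    simp only [hm]; rw [sideFn_add_real_mul hgu, hgP₀]
  -- the rhombus across at `m j`
  have hacross : ∀ j, ∃ dj : G.Dart, dj.edge ≠ d.edge ∧ m j ∈ emb.rhombus ⟨dj.edge, dj.edge_mem⟩ :=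
    fun j => exists_rhombus_across_side hiso hrh hbap hε d hp (hm_open j)
  choose dj hdj_ne hdj_mem using hacross
  have hdj_H : ∀ j, emb.rhombus ⟨(dj j).edge, (dj j).edge_mem⟩ ⊆ {Y | 0 ≤ -s * sideFn S₀ S₁ Y} :=
    fun j => (rhombus_subset_sideOuter hiso hrh d (dj j) (hdj_ne j) hp (hm_open j)
      (hdj_mem j)).trans hconv3
  -- `m j → P₀`
  have hmt : Tendsto m atTop (𝓝 P₀) := by
    have h1 : Tendsto (fun j : ℕ => δ j) atTop (𝓝 0) := by
      have h0 := tendsto_one_div_add_atTop_nhds_zero_nat (𝕜 := ℝ)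
      -- `δ j = (1 - λ) · (1 / (j + 2))`, and `1/(j+2) ≤ 1/(j+1)`
      have h2 : Tendsto (fun j : ℕ => (1 : ℝ) / ((j : ℝ) + 2)) atTop (𝓝 0) := by
        refine squeeze_zero (fun j => by positivity) (fun j => ?_) h0
        apply one_div_le_one_div_of_le (by positivity) (by linarith)
      have h3 := h2.const_mul (1 - lam)
      rw [mul_zero] at h3
      refine h3.congr (fun j => ?_)
      simp only [hδ]; ring
    have h2 : Tendsto (fun j : ℕ => P₀ + ((δ j : ℝ) : ℂ) * u) atTop (𝓝 (P₀ + (0 : ℂ) * u)) :=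
      tendsto_const_nhds.add ((Complex.continuous_ofReal.continuousAt.tendsto.comp h1).mul
        tendsto_const_nhds)
    rw [zero_mul, add_zero] at h2
    exact h2
  obtain ⟨e₁, hP₀e₁, hinf⟩ := exists_rhombus_mem_of_tendsto hiso hrh hbap hε hmt
    (fun j => ⟨(dj j).edge, (dj j).edge_mem⟩) hdj_mem
  obtain ⟨j₀, hj₀⟩ := hinf.nonempty
  set d₁ := RhombicEmbedding.refDart e₁ with hd₁
  have he₁ : (⟨d₁.edge, d₁.edge_mem⟩ : G.edgeSet) = e₁ := Subtype.ext (RhombicEmbedding.refDart_edge e₁)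
  have hj₀' : (⟨(dj j₀).edge, (dj j₀).edge_mem⟩ : G.edgeSet) = ⟨d₁.edge, d₁.edge_mem⟩ := by
    rw [he₁]; exact hj₀
  have hT₁ : emb.rhombus ⟨d₁.edge, d₁.edge_mem⟩ ⊆ {Y | 0 ≤ -s * sideFn S₀ S₁ Y} := by
    rw [← hj₀']; exact hdj_H j₀
  have hm₀ : m j₀ ∈ emb.rhombus ⟨d₁.edge, d₁.edge_mem⟩ := by rw [← hj₀']; exact hdj_mem j₀
  have hP₀₁ : P₀ ∈ emb.rhombus ⟨d₁.edge, d₁.edge_mem⟩ := by rw [he₁]; exact hP₀e₁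
  have hne : P₀ ≠ m j₀ := by
    intro h
    have : ((δ j₀ : ℝ) : ℂ) * u = 0 := by
      have h' := h; simp only [hm] at h'; linear_combination -h'
    rcases mul_eq_zero.1 this with h0 | h0
    · exact (hδpos j₀).ne' (by exact_mod_cast h0)
    · rw [h0, norm_zero] at hu; exact zero_ne_one hu
  -- faces in the supporting line `ℓ` for the rhombus of `d₁ ⊆ H(-s)`
  have hq₁ := dart_isQuad hiso d₁
  rw [rhombus_dart_eq hiso d₁] at hT₁ hm₀ hP₀₁
  have hle : ∀ C, (C = emb.z d₁.fst ∨ C = emb.c (emb.leftFace d₁) ∨ C = emb.z d₁.snd ∨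
      C = emb.c (emb.rightFace d₁)) → s * sideFn S₀ S₁ C ≤ 0 := by
    intro C hC
    obtain ⟨hA, hP, hB, hQ⟩ := corners_mem_convexHull_quad (emb.z d₁.fst)
      (emb.c (emb.leftFace d₁)) (emb.z d₁.snd) (emb.c (emb.rightFace d₁))
    have hCin : C ∈ convexHull ℝ ({emb.z d₁.fst, emb.c (emb.leftFace d₁), emb.z d₁.snd,
        emb.c (emb.rightFace d₁)} : Set ℂ) := by
      rcases hC with rfl | rfl | rfl | rfl <;> assumption
    have := hT₁ hCin
    simp only [mem_setOf_eq] at this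
    linarith
  obtain ⟨C, C', hC, hC', hgC, hgC', hface⟩ :=
    quad_face hq₁ hS hs hle hP₀₁ hm₀ hne hgP₀ (hgm j₀)
  -- the side `p₁ = (v₁, f₁)` of `d₁` with `z v₁ = C`, `c f₁ = C'`
  obtain ⟨p₁, hp₁, hp₁C, hp₁C'⟩ : ∃ p₁ ∈ emb.dartSides d₁, emb.z p₁.1 = C ∧ emb.c p₁.2 = C' := by
    rcases hC with rfl | rfl <;> rcases hC' with rfl | rfl
    · exact ⟨(d₁.fst, emb.leftFace d₁), (mem_dartSides_iff _ _).2 (Or.inl rfl), rfl, rfl⟩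
    · exact ⟨(d₁.fst, emb.rightFace d₁), (mem_dartSides_iff _ _).2 (Or.inr (Or.inr (Or.inr rfl))),
        rfl, rfl⟩
    · exact ⟨(d₁.snd, emb.leftFace d₁), (mem_dartSides_iff _ _).2 (Or.inr (Or.inl rfl)), rfl, rfl⟩
    · exact ⟨(d₁.snd, emb.rightFace d₁), (mem_dartSides_iff _ _).2 (Or.inr (Or.inr (Or.inl rfl))),
        rfl, rfl⟩
  -- `P₀` and `m j₀` lie on the segment `[C, C']`
  have hP₀seg : P₀ ∈ segment ℝ C C' := by rw [← hface]; exact ⟨hP₀₁, hgP₀⟩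
  have hm₀seg : m j₀ ∈ segment ℝ C C' := by rw [← hface]; exact ⟨hm₀, hgm j₀⟩
  rw [← rhombus_dart_eq hiso d₁] at hT₁
  -- `P₀` is an endpoint of `[C, C']`
  have hP₀_not_open : P₀ ∉ openSegment ℝ C C' := by
    intro hopen'
    rw [← hp₁C, ← hp₁C'] at hopen'
    -- the rhombus of `d'` (corner `P₀`) lies across the side `p₁` of `d₁`: in `H(s)` …
    obtain ⟨-, hsub⟩ := rhombus_subset_sideOuter_of_corner hiso hrh d₁ d' hp₁ hZ hopen'
    have hgp1 : sideFn S₀ S₁ (emb.z p₁.1) = 0 := by rw [hp₁C]; exact hgC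
    have hgp2 : sideFn S₀ S₁ (emb.c p₁.2) = 0 := by rw [hp₁C']; exact hgC'
    obtain ⟨-, -, hconv3'⟩ := halfPlane_conv hiso hS (neg_ne_zero.2 hs) hT₁ hp₁ hgp1 hgp2
    have h1 : emb.rhombus ⟨d'.edge, d'.edge_mem⟩ ⊆ {Y | 0 ≤ s * sideFn S₀ S₁ Y} := by
      refine hsub.trans (hconv3'.trans ?_)
      intro Y hY; simpa using hY
    -- … and across the side `p` of `d`: in `H(-s)`
    have hP₀open : P₀ ∈ openSegment ℝ (emb.z p.1) (emb.c p.2) := by rw [hopen]; exact hP₀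
    obtain ⟨-, hsub2⟩ := rhombus_subset_sideOuter_of_corner hiso hrh d d' hp hZ hP₀open
    exact false_of_subset_both hiso hS hs h1 (hsub2.trans hconv3)
  have hCC' : ‖C - C'‖ = 1 := by
    rw [← hp₁C, ← hp₁C']; exact norm_side_eq_one hiso d₁ hp₁
  refine ⟨d₁, hT₁, p₁, hp₁, ?_⟩
  rw [hp₁C, hp₁C']
  rcases Mesh.eq_or_eq_or_mem_openSegment hP₀seg with rfl | rfl | hopen'
  · -- `P₀ = C`: then `C' = P₀ + u`
    have : C' = P₀ + u := by
      refine eq_add_of_mem_segment (hδpos j₀) hu (by rw [norm_sub_rev]; exact hCC') ?_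
      exact hm₀seg
    rw [this]
  · -- `P₀ = C'`: then `C = P₀ + u`
    have : C = P₀ + u := by
      refine eq_add_of_mem_segment (hδpos j₀) hu hCC' ?_
      rw [segment_symm]; exact hm₀seg
    rw [this, Set.pair_comm]
  · exact absurd hopen' hP₀_not_open

/-! ### Propagation: the fault line -/

/-- **One propagation step.** An `H(s)`-rhombus with side `[X, X + u]` and an `H(-s)`-rhombus
with side `[Y, Y + u]`, `X = Y + λ u`, `0 < λ < 1`, produce an `H(-s)`-rhombus with side
`[Y + u, Y + 2u]` (the corner `Y + u` of the second lies in the open side of the first).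
[cite: GrimmettManolescu2014Isoradial, §4.1 (the diamond graph is a rhombic tiling of the plane)] -/
theorem fault_propagate (hiso : emb.IsIsoradial) (hrh : emb.IsRhombicTiling)
    (hbap : emb.HasBoundedAngles ε) (hε : 0 < ε) (hS : S₀ ≠ S₁) (hu : ‖u‖ = 1)
    (hgu : (u * conj (S₁ - S₀)).im = 0) {s : ℝ} (hs : s ≠ 0) {X Y : ℂ} {lam : ℝ}
    (hlam0 : 0 < lam) (hlam1 : lam < 1) (hXY : X = Y + (lam : ℂ) * u) (hY : sideFn S₀ S₁ Y = 0)
    (hT : ∃ d : G.Dart, emb.rhombus ⟨d.edge, d.edge_mem⟩ ⊆ {Z | 0 ≤ s * sideFn S₀ S₁ Z} ∧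
      ∃ p ∈ emb.dartSides d, ({emb.z p.1, emb.c p.2} : Set ℂ) = {X, X + u})
    (hT' : ∃ d' : G.Dart, emb.rhombus ⟨d'.edge, d'.edge_mem⟩ ⊆ {Z | 0 ≤ -s * sideFn S₀ S₁ Z} ∧
      ∃ p' ∈ emb.dartSides d', ({emb.z p'.1, emb.c p'.2} : Set ℂ) = {Y, Y + u}) :
    ∃ d₁ : G.Dart, emb.rhombus ⟨d₁.edge, d₁.edge_mem⟩ ⊆ {Z | 0 ≤ -s * sideFn S₀ S₁ Z} ∧
      ∃ p₁ ∈ emb.dartSides d₁, ({emb.z p₁.1, emb.c p₁.2} : Set ℂ) = {Y + u, Y + u + u} := by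
  obtain ⟨d, hd, p, hp, hside⟩ := hT
  obtain ⟨d', -, p', hp', hside'⟩ := hT'
  have hX : sideFn S₀ S₁ X = 0 := by rw [hXY, sideFn_add_real_mul hgu, hY]
  have hP₀ : Y + u ∈ openSegment ℝ X (X + u) := by
    have : Y + u = X + ((1 - lam : ℝ) : ℂ) * u := by rw [hXY]; push_cast; ring
    rw [this]
    exact add_mul_mem_openSegment X u (by linarith) (by linarith)
  have hZ : Y + u = emb.z d'.fst ∨ Y + u = emb.c (emb.leftFace d') ∨ Y + u = emb.z d'.snd ∨
      Y + u = emb.c (emb.rightFace d') := by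
    apply corner_of_mem_dartSides hp'
    have : Y + u ∈ ({emb.z p'.1, emb.c p'.2} : Set ℂ) := by rw [hside']; simp
    simpa using this
  exact faultStep hiso hrh hbap hε hS hu hgu hs hd hp hX hside hP₀ hZ

/-- **The fault line, forward.** From the initial configuration, for every `k : ℕ` there are an
`H(s)`-rhombus with side `[X + k u, X + (k+1) u]` and an `H(-s)`-rhombus with side
`[Y + k u, Y + (k+1) u]`. [cite: GrimmettManolescu2014Isoradial, §4.1 (the diamond graph is a rhombic tiling of the plane)] -/
theorem fault_forward (hiso : emb.IsIsoradial) (hrh : emb.IsRhombicTiling)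
    (hbap : emb.HasBoundedAngles ε) (hε : 0 < ε) (hS : S₀ ≠ S₁) (hu : ‖u‖ = 1)
    (hgu : (u * conj (S₁ - S₀)).im = 0) {s : ℝ} (hs : s ≠ 0) {X Y : ℂ} {lam : ℝ}
    (hlam0 : 0 < lam) (hlam1 : lam < 1) (hXY : X = Y + (lam : ℂ) * u) (hY : sideFn S₀ S₁ Y = 0)
    (hT : ∃ d : G.Dart, emb.rhombus ⟨d.edge, d.edge_mem⟩ ⊆ {Z | 0 ≤ s * sideFn S₀ S₁ Z} ∧
      ∃ p ∈ emb.dartSides d, ({emb.z p.1, emb.c p.2} : Set ℂ) = {X, X + u})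
    (hT' : ∃ d' : G.Dart, emb.rhombus ⟨d'.edge, d'.edge_mem⟩ ⊆ {Z | 0 ≤ -s * sideFn S₀ S₁ Z} ∧
      ∃ p' ∈ emb.dartSides d', ({emb.z p'.1, emb.c p'.2} : Set ℂ) = {Y, Y + u}) (k : ℕ) :
    (∃ d : G.Dart, emb.rhombus ⟨d.edge, d.edge_mem⟩ ⊆ {Z | 0 ≤ s * sideFn S₀ S₁ Z} ∧
      ∃ p ∈ emb.dartSides d, ({emb.z p.1, emb.c p.2} : Set ℂ) =
        {X + (k : ℂ) * u, X + (k : ℂ) * u + u}) ∧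
    (∃ d' : G.Dart, emb.rhombus ⟨d'.edge, d'.edge_mem⟩ ⊆ {Z | 0 ≤ -s * sideFn S₀ S₁ Z} ∧
      ∃ p' ∈ emb.dartSides d', ({emb.z p'.1, emb.c p'.2} : Set ℂ) =
        {Y + (k : ℂ) * u, Y + (k : ℂ) * u + u}) := by
  induction k with
  | zero => simpa using And.intro hT hT'
  | succ k ih =>
    obtain ⟨ihX, ihY⟩ := ih
    have hXYk : X + (k : ℂ) * u = Y + (k : ℂ) * u + (lam : ℂ) * u := by rw [hXY]; ring
    have hYk : sideFn S₀ S₁ (Y + (k : ℂ) * u) = 0 := by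
      have := sideFn_add_real_mul hgu Y k; push_cast at this; rw [this, hY]
    -- the new `H(-s)`-rhombus at `Y + (k+1) u`
    have hnewY := fault_propagate hiso hrh hbap hε hS hu hgu hs hlam0 hlam1 hXYk hYk ihX ihY
    have hY1 : Y + (k : ℂ) * u + u = Y + ((k + 1 : ℕ) : ℂ) * u := by push_cast; ring
    rw [hY1] at hnewY
    refine ⟨?_, hnewY⟩
    -- the new `H(s)`-rhombus at `X + (k+1) u`, by the step with the roles exchanged
    have hXYk' : Y + ((k + 1 : ℕ) : ℂ) * u = X + (k : ℂ) * u + ((1 - lam : ℝ) : ℂ) * u := by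
      rw [hXY]; push_cast; ring
    have hXk : sideFn S₀ S₁ (X + (k : ℂ) * u) = 0 := by
      rw [hXYk, sideFn_add_real_mul hgu, hYk]
    have ihX' : ∃ d : G.Dart, emb.rhombus ⟨d.edge, d.edge_mem⟩ ⊆ {Z | 0 ≤ -(-s) * sideFn S₀ S₁ Z} ∧
        ∃ p ∈ emb.dartSides d, ({emb.z p.1, emb.c p.2} : Set ℂ) =
          {X + (k : ℂ) * u, X + (k : ℂ) * u + u} := by simpa using ihX
    have hnewX := fault_propagate hiso hrh hbap hε hS hu hgu (neg_ne_zero.2 hs) (by linarith)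
      (by linarith) hXYk' hXk hnewY ihX'
    have hX1 : X + (k : ℂ) * u + u = X + ((k + 1 : ℕ) : ℂ) * u := by push_cast; ring
    rw [hX1] at hnewX
    simpa using hnewX

/-- **The fault line.** From the initial configuration, for every `n : ℤ` there are an
`H(s)`-rhombus with side `[X + n u, X + (n+1) u]` and an `H(-s)`-rhombus with side
`[Y + n u, Y + (n+1) u]` (forward as above; backward by the same argument along `-u` with the
roles of the two families exchanged). [cite: GrimmettManolescu2014Isoradial, §4.1 (the diamond graph is a rhombic tiling of the plane)] -/
theorem fault_all (hiso : emb.IsIsoradial) (hrh : emb.IsRhombicTiling)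
    (hbap : emb.HasBoundedAngles ε) (hε : 0 < ε) (hS : S₀ ≠ S₁) (hu : ‖u‖ = 1)
    (hgu : (u * conj (S₁ - S₀)).im = 0) {s : ℝ} (hs : s ≠ 0) {X Y : ℂ} {lam : ℝ}
    (hlam0 : 0 < lam) (hlam1 : lam < 1) (hXY : X = Y + (lam : ℂ) * u) (hY : sideFn S₀ S₁ Y = 0)
    (hT : ∃ d : G.Dart, emb.rhombus ⟨d.edge, d.edge_mem⟩ ⊆ {Z | 0 ≤ s * sideFn S₀ S₁ Z} ∧
      ∃ p ∈ emb.dartSides d, ({emb.z p.1, emb.c p.2} : Set ℂ) = {X, X + u})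
    (hT' : ∃ d' : G.Dart, emb.rhombus ⟨d'.edge, d'.edge_mem⟩ ⊆ {Z | 0 ≤ -s * sideFn S₀ S₁ Z} ∧
      ∃ p' ∈ emb.dartSides d', ({emb.z p'.1, emb.c p'.2} : Set ℂ) = {Y, Y + u}) (n : ℤ) :
    (∃ d : G.Dart, emb.rhombus ⟨d.edge, d.edge_mem⟩ ⊆ {Z | 0 ≤ s * sideFn S₀ S₁ Z} ∧
      ∃ p ∈ emb.dartSides d, ({emb.z p.1, emb.c p.2} : Set ℂ) =
        {X + (n : ℂ) * u, X + (n : ℂ) * u + u}) ∧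
    (∃ d' : G.Dart, emb.rhombus ⟨d'.edge, d'.edge_mem⟩ ⊆ {Z | 0 ≤ -s * sideFn S₀ S₁ Z} ∧
      ∃ p' ∈ emb.dartSides d', ({emb.z p'.1, emb.c p'.2} : Set ℂ) =
        {Y + (n : ℂ) * u, Y + (n : ℂ) * u + u}) := by
  obtain ⟨k, rfl | rfl⟩ := Int.eq_nat_or_neg n
  · have := fault_forward hiso hrh hbap hε hS hu hgu hs hlam0 hlam1 hXY hY hT hT' k
    simpa using this
  · -- backward: the mirrored configuration along `-u`
    have hu' : ‖-u‖ = 1 := by rw [norm_neg, hu]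
    have hgu' : (-u * conj (S₁ - S₀)).im = 0 := by rw [neg_mul, Complex.neg_im, hgu, neg_zero]
    have hX : sideFn S₀ S₁ X = 0 := by rw [hXY, sideFn_add_real_mul hgu, hY]
    have hXY' : Y + u = (X + u) + (lam : ℂ) * (-u) := by rw [hXY]; ring
    have hXu : sideFn S₀ S₁ (X + u) = 0 := by
      have := sideFn_add_real_mul hgu X 1; push_cast at this; rw [one_mul] at this
      rw [this, hX]
    have hTm : ∃ d : G.Dart, emb.rhombus ⟨d.edge, d.edge_mem⟩ ⊆ {Z | 0 ≤ -s * sideFn S₀ S₁ Z} ∧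
        ∃ p ∈ emb.dartSides d, ({emb.z p.1, emb.c p.2} : Set ℂ) = {Y + u, Y + u + -u} := by
      obtain ⟨d', hd', p', hp', hside'⟩ := hT'
      refine ⟨d', hd', p', hp', ?_⟩
      rw [hside', Set.pair_comm]; congr 1; ring
    have hTm' : ∃ d' : G.Dart, emb.rhombus ⟨d'.edge, d'.edge_mem⟩ ⊆
        {Z | 0 ≤ -(-s) * sideFn S₀ S₁ Z} ∧
        ∃ p' ∈ emb.dartSides d', ({emb.z p'.1, emb.c p'.2} : Set ℂ) = {X + u, X + u + -u} := by
      obtain ⟨d, hd, p, hp, hside⟩ := hT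
      refine ⟨d, by simpa using hd, p, hp, ?_⟩
      rw [hside, Set.pair_comm]; congr 1; ring
    obtain ⟨h1, h2⟩ := fault_forward hiso hrh hbap hε hS hu' hgu' (neg_ne_zero.2 hs) hlam0 hlam1
      hXY' hXu hTm hTm' k
    constructor
    · obtain ⟨d, hd, p, hp, hside⟩ := h2
      refine ⟨d, by simpa using hd, p, hp, ?_⟩
      rw [hside, Set.pair_comm]; push_cast; congr 1 <;> ring
    · obtain ⟨d, hd, p, hp, hside⟩ := h1
      refine ⟨d, hd, p, hp, ?_⟩
      rw [hside, Set.pair_comm]; push_cast; congr 1 <;> ring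

/-! ### Along a fault line the graph is disconnected -/

/-- **Unit cover of the line by a family.** Every point `Z` of `ℓ` lies on a segment
`[B + n u, B + (n+1) u]`, `n ∈ ℤ`, for any base point `B ∈ ℓ` (`u = ±(S₁ - S₀)` a unit vector).
[folklore] -/
theorem exists_mem_segment_of_mem_line (hS : S₀ ≠ S₁) (hS1 : ‖S₁ - S₀‖ = 1) (hu : ‖u‖ = 1)
    (hgu : (u * conj (S₁ - S₀)).im = 0) {B Z : ℂ} (hB : sideFn S₀ S₁ B = 0)
    (hZ : sideFn S₀ S₁ Z = 0) :
    ∃ n : ℤ, Z ∈ segment ℝ (B + (n : ℂ) * u) (B + (n : ℂ) * u + u) := by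
  obtain ⟨b, hb⟩ := eq_add_real_mul_of_sideFn_eq_zero hS hB
  obtain ⟨c, hc⟩ := eq_add_real_mul_of_sideFn_eq_zero hS hZ
  -- `u = ±(S₁ - S₀)`, so `Z = B + τ u` for a real `τ`
  obtain ⟨τ, hτ⟩ : ∃ τ : ℝ, Z = B + (τ : ℂ) * u := by
    rcases eq_or_eq_neg_of_im_eq_zero hu hS1 hgu with h | h
    · exact ⟨c - b, by rw [hc, hb, h]; push_cast; ring⟩
    · exact ⟨b - c, by rw [hc, hb, h]; push_cast; ring⟩
  refine ⟨⌊τ⌋, ?_⟩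
  rw [segment_eq_image]
  refine ⟨τ - ⌊τ⌋, ⟨by linarith [Int.floor_le τ], by linarith [Int.lt_floor_add_one τ]⟩, ?_⟩
  rw [hτ]
  simp only [Complex.real_smul]
  push_cast
  ring

/-- The rhombus of an element of a family with side `[B + n u, B + (n+1) u]` contains that
segment. [folklore] -/
theorem segment_subset_of_side (hiso : emb.IsIsoradial) {d : G.Dart} {p : V × F}
    (hp : p ∈ emb.dartSides d) {X X' : ℂ} (hside : ({emb.z p.1, emb.c p.2} : Set ℂ) = {X, X'}) :
    segment ℝ X X' ⊆ emb.rhombus ⟨d.edge, d.edge_mem⟩ := by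
  rw [← segment_eq_of_pair_eq hside]
  exact segment_side_subset_rhombus hiso hp

/-- **No rhombus has an interior point on a fault line** (half of it: such a rhombus coincides
with the member of the family whose side contains the point, hence lies in `H(t)`).
[cite: GrimmettManolescu2014Isoradial, §4.1 (the diamond graph is a rhombic tiling of the plane)] -/
theorem subset_of_interior_mem_line (hiso : emb.IsIsoradial) (hrh : emb.IsRhombicTiling)
    (hS : S₀ ≠ S₁) (hS1 : ‖S₁ - S₀‖ = 1) (hu : ‖u‖ = 1) (hgu : (u * conj (S₁ - S₀)).im = 0)
    {t : ℝ} {B : ℂ} (hB : sideFn S₀ S₁ B = 0)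
    (hfam : ∀ n : ℤ, ∃ d : G.Dart, emb.rhombus ⟨d.edge, d.edge_mem⟩ ⊆ {Z | 0 ≤ t * sideFn S₀ S₁ Z} ∧
      ∃ p ∈ emb.dartSides d, ({emb.z p.1, emb.c p.2} : Set ℂ) =
        {B + (n : ℂ) * u, B + (n : ℂ) * u + u})
    (d₃ : G.Dart) {m : ℂ} (hm : m ∈ interior (emb.rhombus ⟨d₃.edge, d₃.edge_mem⟩))
    (hgm : sideFn S₀ S₁ m = 0) :
    emb.rhombus ⟨d₃.edge, d₃.edge_mem⟩ ⊆ {Z | 0 ≤ t * sideFn S₀ S₁ Z} := by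
  obtain ⟨n, hn⟩ := exists_mem_segment_of_mem_line hS hS1 hu hgu hB hgm
  obtain ⟨d, hd, p, hp, hside⟩ := hfam n
  have hm' : m ∈ emb.rhombus ⟨d.edge, d.edge_mem⟩ := segment_subset_of_side hiso hp hside hn
  -- the interiors of the rhombi of `d` and `d₃` meet, so `d.edge = d₃.edge`
  have hmeet : (interior (emb.rhombus ⟨d.edge, d.edge_mem⟩) ∩
      interior (emb.rhombus ⟨d₃.edge, d₃.edge_mem⟩)).Nonempty := by
    rw [rhombus_dart_eq hiso d] at hm' ⊢
    exact interior_inter_nonempty (dart_isQuad hiso d) hm' hm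
  have heq : (⟨d.edge, d.edge_mem⟩ : G.edgeSet) = ⟨d₃.edge, d₃.edge_mem⟩ := by
    by_contra hne
    exact Set.not_nonempty_iff_eq_empty.2 (Set.disjoint_iff_inter_eq_empty.1
      (hrh.disjoint_interior hne)) hmeet
  rw [← heq]; exact hd

/-- **A corner on a fault line of an `H(t)`-rhombus lies in the lattice `B + ℤ u` of the
`H(t)`-family.** [cite: GrimmettManolescu2014Isoradial, §4.1 (the diamond graph is a rhombic tiling of the plane)] -/
theorem exists_eq_add_int_mul (hiso : emb.IsIsoradial) (hrh : emb.IsRhombicTiling)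
    (hS : S₀ ≠ S₁) (hS1 : ‖S₁ - S₀‖ = 1) (hu : ‖u‖ = 1) (hgu : (u * conj (S₁ - S₀)).im = 0)
    {t : ℝ} (ht : t ≠ 0) {B : ℂ} (hB : sideFn S₀ S₁ B = 0)
    (hfam : ∀ n : ℤ, ∃ d : G.Dart, emb.rhombus ⟨d.edge, d.edge_mem⟩ ⊆ {Z | 0 ≤ t * sideFn S₀ S₁ Z} ∧
      ∃ p ∈ emb.dartSides d, ({emb.z p.1, emb.c p.2} : Set ℂ) =
        {B + (n : ℂ) * u, B + (n : ℂ) * u + u})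
    {d₃ : G.Dart} (hd₃ : emb.rhombus ⟨d₃.edge, d₃.edge_mem⟩ ⊆ {Z | 0 ≤ t * sideFn S₀ S₁ Z})
    {Z : ℂ} (hZ : Z = emb.z d₃.fst ∨ Z = emb.c (emb.leftFace d₃) ∨ Z = emb.z d₃.snd ∨
      Z = emb.c (emb.rightFace d₃)) (hgZ : sideFn S₀ S₁ Z = 0) :
    ∃ n : ℤ, Z = B + (n : ℂ) * u := by
  obtain ⟨n, hn⟩ := exists_mem_segment_of_mem_line hS hS1 hu hgu hB hgZ
  obtain ⟨d, hd, p, hp, hside⟩ := hfam n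
  rw [← segment_eq_of_pair_eq hside] at hn
  rcases Mesh.eq_or_eq_or_mem_openSegment hn with h | h | hopen
  · have : Z ∈ ({emb.z p.1, emb.c p.2} : Set ℂ) := by rw [h]; simp
    rw [hside] at this
    rcases this with h' | h'
    · exact ⟨n, h'⟩
    · rw [mem_singleton_iff] at h'; exact ⟨n + 1, by rw [h']; push_cast; ring⟩
  · have : Z ∈ ({emb.z p.1, emb.c p.2} : Set ℂ) := by rw [h]; simp
    rw [hside] at this
    rcases this with h' | h'
    · exact ⟨n, h'⟩
    · rw [mem_singleton_iff] at h'; exact ⟨n + 1, by rw [h']; push_cast; ring⟩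
  · exfalso
    obtain ⟨-, hsub⟩ := rhombus_subset_sideOuter_of_corner hiso hrh d d₃ hp hZ hopen
    have hBn : sideFn S₀ S₁ (B + (n : ℂ) * u) = 0 := by
      have := sideFn_add_real_mul hgu B n; push_cast at this; rw [this, hB]
    have hBn1 : sideFn S₀ S₁ (B + (n : ℂ) * u + u) = 0 := by
      have := sideFn_add_real_mul hgu (B + (n : ℂ) * u) 1; push_cast at this
      rw [one_mul] at this; rw [this, hBn]
    have hp1 : sideFn S₀ S₁ (emb.z p.1) = 0 := by
      have : emb.z p.1 ∈ ({B + (n : ℂ) * u, B + (n : ℂ) * u + u} : Set ℂ) := by rw [← hside]; simp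
      rcases this with h | h
      · rw [h, hBn]
      · rw [mem_singleton_iff] at h; rw [h, hBn1]
    have hp2 : sideFn S₀ S₁ (emb.c p.2) = 0 := by
      have : emb.c p.2 ∈ ({B + (n : ℂ) * u, B + (n : ℂ) * u + u} : Set ℂ) := by rw [← hside]; simp
      rcases this with h | h
      · rw [h, hBn]
      · rw [mem_singleton_iff] at h; rw [h, hBn1]
    obtain ⟨-, -, hconv3⟩ := halfPlane_conv hiso hS ht hd hp hp1 hp2
    exact false_of_subset_both hiso hS ht hd₃ (hsub.trans hconv3)

omit [DecidableEq V] [DecidableEq F] in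
/-- **Every rhombus lies on one side of a fault line**: its (convex) interior contains no point
of `ℓ`, hence lies in an open half-plane, and the rhombus is the closure of its interior.
[cite: GrimmettManolescu2014Isoradial, §4.1 (the diamond graph is a rhombic tiling of the plane)] -/
theorem subset_or_subset_of_fault (hiso : emb.IsIsoradial) {s : ℝ} (hs : s ≠ 0)
    (d₃ : G.Dart)
    (hno : ∀ m ∈ interior (emb.rhombus ⟨d₃.edge, d₃.edge_mem⟩), sideFn S₀ S₁ m ≠ 0) :
    emb.rhombus ⟨d₃.edge, d₃.edge_mem⟩ ⊆ {Z | 0 ≤ s * sideFn S₀ S₁ Z} ∨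
      emb.rhombus ⟨d₃.edge, d₃.edge_mem⟩ ⊆ {Z | 0 ≤ -s * sideFn S₀ S₁ Z} := by
  set K := emb.rhombus ⟨d₃.edge, d₃.edge_mem⟩ with hK
  have hq := dart_isQuad hiso d₃
  have hKeq : K = convexHull ℝ {emb.z d₃.fst, emb.c (emb.leftFace d₃), emb.z d₃.snd,
      emb.c (emb.rightFace d₃)} := rhombus_dart_eq hiso d₃
  set M := emb.dartCentre d₃ with hM
  have hMint : M ∈ interior K := by rw [hKeq]; exact centre_mem_interior_quad hq
  have hgM : sideFn S₀ S₁ M ≠ 0 := hno M hMint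
  have hconv : Convex ℝ (interior K) := by rw [hKeq]; exact (convex_convexHull ℝ _).interior
  -- the sign `t ∈ {s, -s}` with `0 < t g M`
  obtain ⟨t, ht, htM⟩ : ∃ t : ℝ, (t = s ∨ t = -s) ∧ 0 < t * sideFn S₀ S₁ M := by
    rcases lt_or_gt_of_ne (mul_ne_zero hs hgM) with h | h
    · exact ⟨-s, Or.inr rfl, by linarith⟩
    · exact ⟨s, Or.inl rfl, h⟩
  -- the interior lies in `{0 < t g}`
  have hint : interior K ⊆ {Z | 0 < t * sideFn S₀ S₁ Z} := by
    intro m hm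
    by_contra hle
    have hle' : t * sideFn S₀ S₁ m ≤ 0 := not_lt.1 hle
    rcases hle'.eq_or_lt with h0 | hneg
    · rcases mul_eq_zero.1 h0 with h | h
      · rcases ht with rfl | rfl
        · exact hs h
        · exact hs (neg_eq_zero.1 h)
      · exact hno m hm h
    · -- intermediate value on the segment `[M, m] ⊆ interior K`
      set a := t * sideFn S₀ S₁ M with ha
      set b := t * sideFn S₀ S₁ m with hb
      set θ := a / (a - b) with hθ
      have hab : 0 < a - b := by linarith
      have hθ0 : 0 < θ := div_pos htM hab
      have hθ1 : θ < 1 := by rw [hθ, div_lt_one hab]; linarith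
      set w := (1 - θ) • M + θ • m with hw
      have hwint : w ∈ interior K := hconv hMint hm (by linarith) hθ0.le (by ring)
      have hgw : t * sideFn S₀ S₁ w = 0 := by
        rw [hw, sideFn_combo S₀ S₁ M m (by ring : (1 - θ) + θ = 1), mul_add, ← mul_assoc,
          ← mul_assoc, mul_comm t (1 - θ), mul_comm t θ, mul_assoc, mul_assoc, ← ha, ← hb, hθ]
        field_simp
        ring
      rcases mul_eq_zero.1 hgw with h | h
      · rcases ht with rfl | rfl
        · exact hs h
        · exact hs (neg_eq_zero.1 h)
      · exact hno w hwint h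
  -- hence `K ⊆ closure (interior K) ⊆ {0 ≤ t g}`
  have hKsub : K ⊆ {Z | 0 ≤ t * sideFn S₀ S₁ Z} := by
    have hcl : K ⊆ closure (interior K) := by rw [hKeq]; exact subset_closure_interior_quad hq
    refine hcl.trans (closure_minimal
      (hint.trans fun Z hZ => show 0 ≤ t * sideFn S₀ S₁ Z from le_of_lt hZ) ?_)
    exact isClosed_le continuous_const (continuous_const.mul (continuous_sideFn S₀ S₁))
  rcases ht with rfl | rfl
  · exact Or.inl hKsub
  · exact Or.inr hKsub

/-- **A fault line disconnects the graph.** Given a fault line — `H(s)`-rhombi with sides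
`[X + n u, X + (n+1) u]` and `H(-s)`-rhombi with sides `[Y + n u, Y + (n+1) u]` for all
`n ∈ ℤ`, `X = Y + λ u`, `0 < λ < 1` — the graph `G` is not preconnected.
[cite: GrimmettManolescu2014Isoradial, §4.1 (the diamond graph is a rhombic tiling of the plane)] -/
theorem false_of_fault (hconn : G.Preconnected) (hiso : emb.IsIsoradial) (hrh : emb.IsRhombicTiling)
    (hS : S₀ ≠ S₁) (hS1 : ‖S₁ - S₀‖ = 1) (hu : ‖u‖ = 1) (hgu : (u * conj (S₁ - S₀)).im = 0)
    {s : ℝ} (hs : s ≠ 0) {X Y : ℂ} {lam : ℝ} (hlam0 : 0 < lam) (hlam1 : lam < 1)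
    (hXY : X = Y + (lam : ℂ) * u) (hY : sideFn S₀ S₁ Y = 0)
    (hfault : ∀ n : ℤ,
      (∃ d : G.Dart, emb.rhombus ⟨d.edge, d.edge_mem⟩ ⊆ {Z | 0 ≤ s * sideFn S₀ S₁ Z} ∧
        ∃ p ∈ emb.dartSides d, ({emb.z p.1, emb.c p.2} : Set ℂ) =
          {X + (n : ℂ) * u, X + (n : ℂ) * u + u}) ∧
      (∃ d' : G.Dart, emb.rhombus ⟨d'.edge, d'.edge_mem⟩ ⊆ {Z | 0 ≤ -s * sideFn S₀ S₁ Z} ∧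
        ∃ p' ∈ emb.dartSides d', ({emb.z p'.1, emb.c p'.2} : Set ℂ) =
          {Y + (n : ℂ) * u, Y + (n : ℂ) * u + u})) : False := by
  have hX : sideFn S₀ S₁ X = 0 := by rw [hXY, sideFn_add_real_mul hgu, hY]
  have hu0 : u ≠ 0 := by rintro rfl; rw [norm_zero] at hu; exact zero_ne_one hu
  have hfamX := fun n => (hfault n).1
  have hfamY := fun n => (hfault n).2
  -- (b) no rhombus has an interior point on `ℓ`
  have hno : ∀ (d₃ : G.Dart), ∀ m ∈ interior (emb.rhombus ⟨d₃.edge, d₃.edge_mem⟩),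
      sideFn S₀ S₁ m ≠ 0 := by
    intro d₃ m hm hgm
    exact false_of_subset_both hiso hS hs
      (subset_of_interior_mem_line hiso hrh hS hS1 hu hgu hX hfamX d₃ hm hgm)
      (subset_of_interior_mem_line hiso hrh hS hS1 hu hgu hY hfamY d₃ hm hgm)
  -- (e) the two lattices are disjoint
  have hdisj : ∀ n n' : ℤ, X + (n : ℂ) * u ≠ Y + (n' : ℂ) * u := by
    intro n n' h
    rw [hXY] at h
    have h1 : ((lam + n - n' : ℝ) : ℂ) * u = 0 := by push_cast; linear_combination h
    rcases mul_eq_zero.1 h1 with h2 | h2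
    · have h3 : lam + n - n' = 0 := by exact_mod_cast h2
      have h4 : lam = ((n' - n : ℤ) : ℝ) := by push_cast; linarith
      rw [h4] at hlam0 hlam1
      have h5 : (0 : ℤ) < n' - n := by exact_mod_cast hlam0
      have h6 : n' - n < (1 : ℤ) := by exact_mod_cast hlam1
      omega
    · exact hu0 h2
  -- (f) the side predicate
  let up : V → Prop := fun x => ∃ d₃ : G.Dart, d₃.fst = x ∧
    emb.rhombus ⟨d₃.edge, d₃.edge_mem⟩ ⊆ {Z | 0 ≤ s * sideFn S₀ S₁ Z}
  have hnot_up : ∀ d₃ : G.Dart, emb.rhombus ⟨d₃.edge, d₃.edge_mem⟩ ⊆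
      {Z | 0 ≤ -s * sideFn S₀ S₁ Z} → ¬ up d₃.fst := by
    rintro d₃ hd₃ ⟨d₄, h4, hd₄⟩
    set Z := emb.z d₃.fst with hZ
    have hZ3 : Z ∈ emb.rhombus ⟨d₃.edge, d₃.edge_mem⟩ := by
      rw [rhombus_dart_eq hiso d₃]; exact (corners_mem_convexHull_quad _ _ _ _).1
    have hZ4 : Z ∈ emb.rhombus ⟨d₄.edge, d₄.edge_mem⟩ := by
      rw [rhombus_dart_eq hiso d₄, hZ, ← h4]; exact (corners_mem_convexHull_quad _ _ _ _).1
    have hgZ : sideFn S₀ S₁ Z = 0 := by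
      have a : 0 ≤ s * sideFn S₀ S₁ Z := hd₄ hZ4
      have b : 0 ≤ -s * sideFn S₀ S₁ Z := hd₃ hZ3
      have : s * sideFn S₀ S₁ Z = 0 := by linarith
      rcases mul_eq_zero.1 this with h | h
      · exact absurd h hs
      · exact h
    obtain ⟨n, hn⟩ := exists_eq_add_int_mul hiso hrh hS hS1 hu hgu hs hX hfamX hd₄
      (Or.inl (by rw [h4])) hgZ
    obtain ⟨n', hn'⟩ := exists_eq_add_int_mul hiso hrh hS hS1 hu hgu (neg_ne_zero.2 hs) hY hfamY
      hd₃ (Or.inl rfl) hgZ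
    exact hdisj n n' (hn.symm.trans hn')
  have hiff : ∀ d₃ : G.Dart, up d₃.fst ↔ up d₃.snd := by
    intro d₃
    have hsymm : emb.rhombus ⟨d₃.symm.edge, d₃.symm.edge_mem⟩ = emb.rhombus ⟨d₃.edge, d₃.edge_mem⟩ := by
      rw [rhombus_dart_symm]
    rcases subset_or_subset_of_fault hiso hs d₃ (hno d₃) with h | h
    · exact ⟨fun _ => ⟨d₃.symm, rfl, by rw [hsymm]; exact h⟩, fun _ => ⟨d₃, rfl, h⟩⟩
    · constructor
      · intro h'; exact absurd h' (hnot_up d₃ h)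
      · intro h'
        have := hnot_up d₃.symm (by rw [hsymm]; exact h)
        exact absurd h' this
  have hreach : ∀ x y : V, G.Reachable x y → (up x ↔ up y) := by
    intro x y ⟨w⟩
    induction w with
    | nil => exact Iff.rfl
    | @cons a b _ hab _ ih => exact (hiff ⟨(a, b), hab⟩).trans ih
  -- both sides occur
  obtain ⟨⟨d₀, hd₀, -⟩, ⟨d₀', hd₀', -⟩⟩ := hfault 0
  have h1 : up d₀.fst := ⟨d₀, rfl, hd₀⟩
  have h2 : ¬ up d₀'.fst := hnot_up d₀' hd₀'
  exact h2 ((hreach _ _ (hconn d₀.fst d₀'.fst)).1 h1)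

end Line

end FaultLine

/-! ### Main theorem: no T-junctions -/

/-- **A rhombic tiling of a connected graph is edge-to-edge: no corner of a rhombus lies in an
open side of a rhombus.** For a preconnected `G`, an isoradial `emb` with the tiling condition
and bounded angles, no vertex position `z x` and no face-centre position `c f` of a dart of `G`
lies in the open side `(z v, c f')`, `(v, f') ∈ dartSides d`, of the rhombus of any dart `d`
(otherwise the line of that side would be a fault line and `G` would be disconnected,
`FaultLine.false_of_fault`). This is the combinatorial half of Grimmett–Manolescu's standing
assumption that the diamond graph is "a planar graph embedded in `ℝ²` such that every face is a
rhombus". [cite: GrimmettManolescu2014Isoradial, §4.1 (rhombic tiling = planar graph with rhombic faces)] -/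
theorem corner_not_mem_openSegment_side (hconn : G.Preconnected) (hiso : emb.IsIsoradial)
    (hrh : emb.IsRhombicTiling) (hbap : emb.HasBoundedAngles ε) (hε : 0 < ε) (d d' : G.Dart)
    {p : V × F} (hp : p ∈ emb.dartSides d) {Z : ℂ}
    (hZ : Z = emb.z d'.fst ∨ Z = emb.c (emb.leftFace d') ∨ Z = emb.z d'.snd ∨
      Z = emb.c (emb.rightFace d')) :
    Z ∉ openSegment ℝ (emb.z p.1) (emb.c p.2) := by
  intro hZm
  -- the line `ℓ` of the side `p`, its unit vector `e = S₁ - S₀`, the sign `s = g M` of `T = rhombus d`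
  set S₀ := emb.z p.1 with hS₀
  set S₁ := emb.c p.2 with hS₁
  have hS : S₀ ≠ S₁ := z_ne_c_of_mem_dartSides hiso d hp
  have hS1 : ‖S₁ - S₀‖ = 1 := by rw [norm_sub_rev]; exact norm_side_eq_one hiso d hp
  set s := sideFn S₀ S₁ (emb.dartCentre d) with hs_def
  have hs : s ≠ 0 := sideFn_dartCentre_ne_zero hiso d hp
  have hT : emb.rhombus ⟨d.edge, d.edge_mem⟩ ⊆ {Y | 0 ≤ s * sideFn S₀ S₁ Y} :=
    FaultLine.rhombus_subset_halfPlane_self hiso hp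
  -- `Z = S₀ + λ e`
  obtain ⟨lam, hlam0, hlam1, hZeq⟩ : ∃ t : ℝ, 0 < t ∧ t < 1 ∧ Z = S₀ + (t : ℂ) * (S₁ - S₀) := by
    apply FaultLine.exists_of_mem_openSegment
    have : S₀ + (S₁ - S₀) = S₁ := by ring
    rw [this]; exact hZm
  -- the fault step along `-e` from the corner `Z`: an `H(-s)`-rhombus with side `[Z - e, Z]`
  set u' : ℂ := S₀ - S₁ with hu'
  have hu'1 : ‖u'‖ = 1 := by rw [hu', norm_sub_rev]; exact hS1
  have hgu' : (u' * conj (S₁ - S₀)).im = 0 := by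
    have : u' * conj (S₁ - S₀) = -((S₁ - S₀) * conj (S₁ - S₀)) := by rw [hu']; ring
    rw [this, Complex.neg_im, Complex.mul_conj, Complex.ofReal_im, neg_zero]
  have hsideT : ({emb.z p.1, emb.c p.2} : Set ℂ) = {S₁, S₁ + u'} := by
    have : S₁ + u' = S₀ := by rw [hu']; ring
    rw [this]; exact Set.pair_comm _ _
  have hS₁0 : sideFn S₀ S₁ S₁ = 0 := sideFn_right _ _
  have hP₀ : Z ∈ openSegment ℝ S₁ (S₁ + u') := by
    have : S₁ + u' = S₀ := by rw [hu']; ring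
    rw [this, openSegment_symm]; exact hZm
  obtain ⟨d₁, hd₁, p₁, hp₁, hside₁⟩ :=
    FaultLine.faultStep hiso hrh hbap hε hS hu'1 hgu' hs hT hp hS₁0 hsideT hP₀ hZ
  -- the fault line along `e = S₁ - S₀`: `X = S₀`, `Y = Z - e`, `λ' = 1 - λ`
  set e : ℂ := S₁ - S₀ with he
  have hgu : (e * conj (S₁ - S₀)).im = 0 := by
    rw [he, Complex.mul_conj, Complex.ofReal_im]
  have hY : sideFn S₀ S₁ (Z + u') = 0 := by
    have h1 : sideFn S₀ S₁ Z = 0 := by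
      rw [hZeq, FaultLine.sideFn_add_real_mul hgu, sideFn_left]
    have := FaultLine.sideFn_add_real_mul hgu' Z 1
    push_cast at this; rw [one_mul] at this; rw [this, h1]
  have hXY : S₀ = (Z + u') + ((1 - lam : ℝ) : ℂ) * e := by
    rw [hZeq, hu', he]; push_cast; ring
  have hTX : ∃ d₀ : G.Dart, emb.rhombus ⟨d₀.edge, d₀.edge_mem⟩ ⊆ {Y | 0 ≤ s * sideFn S₀ S₁ Y} ∧
      ∃ p₀ ∈ emb.dartSides d₀, ({emb.z p₀.1, emb.c p₀.2} : Set ℂ) = {S₀, S₀ + e} := by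
    have : S₀ + e = S₁ := by rw [he]; ring
    refine ⟨d, hT, p, hp, ?_⟩
    rw [this]
  have hTY : ∃ d₀ : G.Dart, emb.rhombus ⟨d₀.edge, d₀.edge_mem⟩ ⊆ {Y | 0 ≤ -s * sideFn S₀ S₁ Y} ∧
      ∃ p₀ ∈ emb.dartSides d₀, ({emb.z p₀.1, emb.c p₀.2} : Set ℂ) = {Z + u', Z + u' + e} := by
    refine ⟨d₁, hd₁, p₁, hp₁, ?_⟩
    have : Z + u' + e = Z := by rw [hu', he]; ring
    rw [hside₁, this, Set.pair_comm]
  have he1 : ‖e‖ = 1 := by rw [he]; exact hS1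
  have hfault := FaultLine.fault_all hiso hrh hbap hε hS he1 hgu hs (by linarith) (by linarith)
    hXY hY hTX hTY
  exact FaultLine.false_of_fault hconn hiso hrh hS hS1 he1 hgu hs (by linarith) (by linarith)
    hXY hY hfault

end Literature.Probability.Percolation

end

/-!
# Planarity of rhombic tilings, V: the tiling is edge-to-edge

Topic `Literature/Probability/Percolation`. Consequence of the fault-line theorem
`corner_not_mem_openSegment_side` (file IV): for a preconnected `G` isoradially embedded with
the tiling condition and bounded angles (`PlanarTilingHyps`), **across every side of every
rhombus there is exactly one other rhombus, and it has the same segment as a side**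
(`exists_across`, `edge_eq_of_across`). This is the statement "each side of a rhombus of `G^◇`
is a side of exactly one other rhombus" underlying the definition of train tracks
(Grimmett–Manolescu 2014, §4.1–4.2: "a track is a doubly infinite sequence of rhombi, each
sharing a side with the next"; de Bruijn 1981, §4) — here for the *geometric* sides (point
sets); that the labels `(v, f)` of the shared side also agree is the corner-consistency theorem
of the sequel. We also package the standing hypotheses (`PlanarTilingHyps`) and the resulting
map `acrossEdge` (the edge across the side `p` of the rhombus of `e`) with its defining
properties, the input of de Bruijn's ribbons.

## References

* G. R. Grimmett, I. Manolescu, *Bond percolation on isoradial graphs*, PTRF 159 (2014),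
  arXiv:1204.0505, §4.1–4.2.
* N. G. de Bruijn, *Algebraic theory of Penrose's non-periodic tilings*, Indag. Math. 43 (1981), §4.
* B. Grünbaum, G. C. Shephard, *Tilings and Patterns* (1987), §1.1 (edge-to-edge tilings).
-/

noncomputable section

open Complex ComplexConjugate Metric Set Filter Topology

namespace Literature.Probability.Percolation

open Literature.Probability.LatticeModels IsoradialCriticality

variable {V F : Type*} {G : SimpleGraph V} {emb : RhombicEmbedding G F} {ε : ℝ}

/-- The standing hypotheses of the planarity theory of rhombic tilings: `G` preconnected,
`emb` isoradial with the tiling condition, bounded angles BAP(ε) with `ε > 0` (the class of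
Grimmett–Manolescu 2014, §2.1 and §4.1, minus the square-grid property).
[cite: GrimmettManolescu2014Isoradial, §2.1 and §4.1 (isoradial graphs and rhombic tilings)] -/
structure PlanarTilingHyps (emb : RhombicEmbedding G F) (ε : ℝ) : Prop where
  conn : G.Preconnected
  iso : emb.IsIsoradial
  tiling : emb.IsRhombicTiling
  bap : emb.HasBoundedAngles ε
  pos : 0 < ε

variable [DecidableEq V] [DecidableEq F]

namespace EdgeToEdge

/-- The side of `d'` with prescribed corner points `C ∈ {A, B}`, `C' ∈ {P, Q}`. [folklore] -/
theorem exists_side_of_corners (d' : G.Dart) {C C' : ℂ}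
    (hC : C = emb.z d'.fst ∨ C = emb.z d'.snd)
    (hC' : C' = emb.c (emb.leftFace d') ∨ C' = emb.c (emb.rightFace d')) :
    ∃ p' ∈ emb.dartSides d', emb.z p'.1 = C ∧ emb.c p'.2 = C' := by
  rcases hC with rfl | rfl <;> rcases hC' with rfl | rfl
  · exact ⟨(d'.fst, emb.leftFace d'), (mem_dartSides_iff _ _).2 (Or.inl rfl), rfl, rfl⟩
  · exact ⟨(d'.fst, emb.rightFace d'), (mem_dartSides_iff _ _).2 (Or.inr (Or.inr (Or.inr rfl))),
      rfl, rfl⟩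
  · exact ⟨(d'.snd, emb.leftFace d'), (mem_dartSides_iff _ _).2 (Or.inr (Or.inl rfl)), rfl, rfl⟩
  · exact ⟨(d'.snd, emb.rightFace d'), (mem_dartSides_iff _ _).2 (Or.inr (Or.inr (Or.inl rfl))),
      rfl, rfl⟩

/-- The midpoint of a side lies in the open side. [folklore] -/
theorem midpoint_mem_openSegment (A P : ℂ) :
    (A + P) / 2 ∈ openSegment ℝ A P := by
  refine ⟨1 / 2, 1 / 2, by norm_num, by norm_num, by norm_num, ?_⟩
  simp only [Complex.real_smul]; push_cast; ring

/-- **Two unit segments on a line which share the midpoint of one of them, no endpoint of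
either lying in the open part of the other, coincide.** (In a coordinate along the line the
second segment is `[c, c + 1] ∋ 1/2` with `c, c + 1 ∉ (0, 1)`, so `c = 0`.) [folklore] -/
theorem pair_eq_of_unit_segments {A w C C' : ℂ} (hw : ‖w‖ = 1) {c c' : ℝ}
    (hC : C = A + (c : ℂ) * w) (hC' : C' = A + (c' : ℂ) * w) (hCC' : ‖C - C'‖ = 1)
    (hm : A + ((1 / 2 : ℝ) : ℂ) * w ∈ segment ℝ C C')
    (hc : ¬ (0 < c ∧ c < 1)) (hc' : ¬ (0 < c' ∧ c' < 1)) :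
    ({C, C'} : Set ℂ) = {A, A + w} := by
  have hw0 : w ≠ 0 := by rintro rfl; simp at hw
  -- `|c - c'| = 1`
  have habs : |c - c'| = 1 := by
    have : C - C' = ((c - c' : ℝ) : ℂ) * w := by rw [hC, hC']; push_cast; ring
    rw [this, norm_mul, Complex.norm_real, Real.norm_eq_abs, hw, mul_one] at hCC'
    exact hCC'
  -- `1/2 = (1 - θ) c + θ c'`
  obtain ⟨θ, hθ0, hθ1, hθ⟩ : ∃ θ : ℝ, 0 ≤ θ ∧ θ ≤ 1 ∧ (1 / 2 : ℝ) = (1 - θ) * c + θ * c' := by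
    rw [segment_eq_image] at hm
    obtain ⟨θ, ⟨hθ0, hθ1⟩, hθ⟩ := hm
    refine ⟨θ, hθ0, hθ1, ?_⟩
    have h1 : (((1 - θ) * c + θ * c' - 1 / 2 : ℝ) : ℂ) * w = 0 := by
      rw [hC, hC'] at hθ
      simp only [Complex.real_smul] at hθ
      push_cast at hθ ⊢
      linear_combination hθ
    rcases mul_eq_zero.1 h1 with h | h
    · have : (1 - θ) * c + θ * c' - 1 / 2 = 0 := by exact_mod_cast h
      linarith
    · exact absurd h hw0
  rcases abs_eq (zero_le_one) |>.1 habs with h | h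
  · -- `c' = c - 1`: then `c = 1/2 + θ`, and `c = 1`, `c' = 0`
    have hcθ : c = 1 / 2 + θ := by
      have : c' = c - 1 := by linarith
      rw [this] at hθ; linarith
    have hc1 : 1 ≤ c := by
      by_contra h'
      exact hc ⟨by linarith, by linarith⟩
    have hc1' : c ≤ 1 := by
      by_contra h'
      exact hc' ⟨by linarith, by linarith⟩
    have h1 : c = 1 := le_antisymm hc1' hc1
    have h2 : c' = 0 := by linarith
    rw [hC, hC', h1, h2, Set.pair_comm]; push_cast; simp
  · -- `c' = c + 1`: then `c = 1/2 - θ`, and `c = 0`, `c' = 1`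
    have hcθ : c = 1 / 2 - θ := by
      have : c' = c + 1 := by linarith
      rw [this] at hθ; linarith
    have hc0 : c ≤ 0 := by
      by_contra h'
      exact hc ⟨by linarith, by linarith⟩
    have hc0' : 0 ≤ c := by
      by_contra h'
      exact hc' ⟨by linarith, by linarith⟩
    have h1 : c = 0 := le_antisymm hc0 hc0'
    have h2 : c' = 1 := by linarith
    rw [hC, hC', h1, h2]; push_cast; simp

/-- **Edge-to-edge: existence.** Across each side `p` of the rhombus of `d` there is a rhombus
of another edge having the same segment as a side. [cite: GrimmettManolescu2014Isoradial, §4.1–4.2 (each side of a rhombus is shared with the next rhombus of a track)] -/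
theorem exists_across (H : PlanarTilingHyps emb ε) (d : G.Dart) {p : V × F}
    (hp : p ∈ emb.dartSides d) :
    ∃ d' : G.Dart, d'.edge ≠ d.edge ∧ ∃ p' ∈ emb.dartSides d',
      ({emb.z p'.1, emb.c p'.2} : Set ℂ) = {emb.z p.1, emb.c p.2} := by
  have hiso := H.iso
  set A' := emb.z p.1 with hA'
  set P' := emb.c p.2 with hP'
  have hAP : A' ≠ P' := z_ne_c_of_mem_dartSides hiso d hp
  have hAP1 : ‖A' - P'‖ = 1 := norm_side_eq_one hiso d hp
  set m : ℂ := (A' + P') / 2 with hm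
  have hm_open : m ∈ openSegment ℝ A' P' := midpoint_mem_openSegment A' P'
  have hgm : sideFn A' P' m = 0 := by
    have : m = (1 / 2 : ℝ) • A' + (1 / 2 : ℝ) • P' := by
      simp only [hm, Complex.real_smul]; push_cast; ring
    rw [this, sideFn_combo A' P' A' P' (by norm_num : (1 / 2 : ℝ) + 1 / 2 = 1)]; simp
  obtain ⟨d', hne, hmd'⟩ := exists_rhombus_across_side hiso H.tiling H.bap H.pos d hp hm_open
  -- the rhombus of `d'` lies in the outer half-plane `{s · g ≤ 0}`
  set s := sideFn A' P' (emb.dartCentre d) with hs_def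
  have hs : s ≠ 0 := sideFn_dartCentre_ne_zero hiso d hp
  have hout := rhombus_subset_sideOuter hiso H.tiling d d' hne hp hm_open hmd'
  have hq' := dart_isQuad hiso d'
  have hK' := rhombus_dart_eq hiso d'
  have hle : ∀ C, (C = emb.z d'.fst ∨ C = emb.c (emb.leftFace d') ∨ C = emb.z d'.snd ∨
      C = emb.c (emb.rightFace d')) → s * sideFn A' P' C ≤ 0 := by
    intro C hC
    obtain ⟨hA, hP, hB, hQ⟩ := corners_mem_convexHull_quad (emb.z d'.fst)
      (emb.c (emb.leftFace d')) (emb.z d'.snd) (emb.c (emb.rightFace d'))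
    have hCin : C ∈ emb.rhombus ⟨d'.edge, d'.edge_mem⟩ := by
      rw [hK']; rcases hC with rfl | rfl | rfl | rfl <;> assumption
    have := hout hCin
    change sideFn A' P' C * s ≤ 0 at this
    linarith [mul_comm (sideFn A' P' C) s]
  -- some corner `C₀` of `d'` lies on the line
  obtain ⟨C₀, hC₀, hgC₀⟩ : ∃ C₀, (C₀ = emb.z d'.fst ∨ C₀ = emb.c (emb.leftFace d') ∨
      C₀ = emb.z d'.snd ∨ C₀ = emb.c (emb.rightFace d')) ∧ sideFn A' P' C₀ = 0 := by
    by_contra hcon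
    push Not at hcon
    have hlt : ∀ C, (C = emb.z d'.fst ∨ C = emb.c (emb.leftFace d') ∨ C = emb.z d'.snd ∨
        C = emb.c (emb.rightFace d')) → s * sideFn A' P' C < 0 := fun C hC =>
      lt_of_le_of_ne (hle C hC) (fun h0 => by
        rcases mul_eq_zero.1 h0 with h | h
        · exact hs h
        · exact hcon C hC h)
    have hsub : emb.rhombus ⟨d'.edge, d'.edge_mem⟩ ⊆ {Y | s * sideFn A' P' Y < 0} := by
      rw [hK']
      refine convexHull_min ?_ ?_
      · intro C hC
        simp only [mem_insert_iff, mem_singleton_iff] at hC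
        exact hlt C hC
      · intro X hX Y hY u v hu hv huv
        simp only [mem_setOf_eq] at hX hY ⊢
        rw [sideFn_combo A' P' X Y huv, mul_add, ← mul_assoc, ← mul_assoc, mul_comm s u,
          mul_comm s v, mul_assoc, mul_assoc]
        rcases hu.eq_or_lt with rfl | hu'
        · rw [zero_add] at huv; rw [huv]; simpa using hY
        · nlinarith [mul_nonpos_of_nonneg_of_nonpos hv hY.le]
    have := hsub hmd'
    simp only [mem_setOf_eq, hgm, mul_zero, lt_self_iff_false] at this
  -- `C₀ ≠ m`: no T-junction
  have hC₀m : m ≠ C₀ := by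
    intro h
    exact corner_not_mem_openSegment_side H.conn hiso H.tiling H.bap H.pos d d' hp hC₀
      (h ▸ hm_open)
  -- faces in the supporting line: a side `[C, C']` of `d'` on the line containing `m`
  have hmK : m ∈ convexHull ℝ ({emb.z d'.fst, emb.c (emb.leftFace d'), emb.z d'.snd,
      emb.c (emb.rightFace d')} : Set ℂ) := by rw [← hK']; exact hmd'
  have hC₀K : C₀ ∈ convexHull ℝ ({emb.z d'.fst, emb.c (emb.leftFace d'), emb.z d'.snd,
      emb.c (emb.rightFace d')} : Set ℂ) := by
    obtain ⟨hA, hP, hB, hQ⟩ := corners_mem_convexHull_quad (emb.z d'.fst)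
      (emb.c (emb.leftFace d')) (emb.z d'.snd) (emb.c (emb.rightFace d'))
    rcases hC₀ with rfl | rfl | rfl | rfl <;> assumption
  obtain ⟨C, C', hC, hC', hgC, hgC', hface⟩ := quad_face hq' hAP hs hle hmK hC₀K hC₀m hgm hgC₀
  obtain ⟨p', hp', hp'C, hp'C'⟩ := exists_side_of_corners d' hC hC'
  refine ⟨d', hne, p', hp', ?_⟩
  rw [hp'C, hp'C']
  -- coordinates along the line: `C = A' + c w`, `C' = A' + c' w`, `w = P' - A'`
  obtain ⟨c, hc⟩ := eq_add_real_mul_of_sideFn_eq_zero hAP hgC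
  obtain ⟨c', hc'⟩ := eq_add_real_mul_of_sideFn_eq_zero hAP hgC'
  have hw : ‖P' - A'‖ = 1 := by rw [norm_sub_rev]; exact hAP1
  have hCC' : ‖C - C'‖ = 1 := by rw [← hp'C, ← hp'C']; exact norm_side_eq_one hiso d' hp'
  have hmseg : A' + ((1 / 2 : ℝ) : ℂ) * (P' - A') ∈ segment ℝ C C' := by
    have : A' + ((1 / 2 : ℝ) : ℂ) * (P' - A') = m := by simp only [hm]; push_cast; ring
    rw [this, ← hface]; exact ⟨hmK, hgm⟩
  have hP'eq : A' + (P' - A') = P' := by ring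
  -- no T-junctions: `C, C' ∉ (A', P')`
  have hCcorner : C = emb.z d'.fst ∨ C = emb.c (emb.leftFace d') ∨ C = emb.z d'.snd ∨
      C = emb.c (emb.rightFace d') := by rcases hC with h | h <;> simp [h]
  have hC'corner : C' = emb.z d'.fst ∨ C' = emb.c (emb.leftFace d') ∨ C' = emb.z d'.snd ∨
      C' = emb.c (emb.rightFace d') := by rcases hC' with h | h <;> simp [h]
  have hc01 : ¬ (0 < c ∧ c < 1) := by
    rintro ⟨h0, h1⟩
    apply corner_not_mem_openSegment_side H.conn hiso H.tiling H.bap H.pos d d' hp hCcorner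
    show C ∈ openSegment ℝ A' P'
    have := FaultLine.add_mul_mem_openSegment A' (P' - A') h0 h1
    rw [hP'eq] at this
    rw [hc]; exact this
  have hc'01 : ¬ (0 < c' ∧ c' < 1) := by
    rintro ⟨h0, h1⟩
    apply corner_not_mem_openSegment_side H.conn hiso H.tiling H.bap H.pos d d' hp hC'corner
    show C' ∈ openSegment ℝ A' P'
    have := FaultLine.add_mul_mem_openSegment A' (P' - A') h0 h1
    rw [hP'eq] at this
    rw [hc']; exact this
  have := pair_eq_of_unit_segments hw hc hc' hCC' hmseg hc01 hc'01
  rw [this, hP'eq]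

/-- **Edge-to-edge: uniqueness.** Two rhombi other than that of `d` having (a side with) the
same segment as the side `p` of the rhombus of `d` are the same rhombus (their half-discs across
the side overlap). [cite: GrimmettManolescu2014Isoradial, §4.1–4.2 (each side of a rhombus is shared with exactly one other rhombus)] -/
theorem edge_eq_of_across (H : PlanarTilingHyps emb ε) (d : G.Dart) {p : V × F}
    (hp : p ∈ emb.dartSides d) {d₁ d₂ : G.Dart} (h₁ : d₁.edge ≠ d.edge) (h₂ : d₂.edge ≠ d.edge)
    {p₁ p₂ : V × F} (hp₁ : p₁ ∈ emb.dartSides d₁) (hp₂ : p₂ ∈ emb.dartSides d₂)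
    (hs₁ : ({emb.z p₁.1, emb.c p₁.2} : Set ℂ) = {emb.z p.1, emb.c p.2})
    (hs₂ : ({emb.z p₂.1, emb.c p₂.2} : Set ℂ) = {emb.z p.1, emb.c p.2}) :
    d₁.edge = d₂.edge := by
  have hiso := H.iso
  set A' := emb.z p.1 with hA'
  set P' := emb.c p.2 with hP'
  have hAP : A' ≠ P' := z_ne_c_of_mem_dartSides hiso d hp
  have hAP1 : ‖A' - P'‖ = 1 := norm_side_eq_one hiso d hp
  set m : ℂ := (A' + P') / 2 with hm
  have hm_open : m ∈ openSegment ℝ A' P' := midpoint_mem_openSegment A' P'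
  have hgm : sideFn A' P' m = 0 := by
    have : m = (1 / 2 : ℝ) • A' + (1 / 2 : ℝ) • P' := by
      simp only [hm, Complex.real_smul]; push_cast; ring
    rw [this, sideFn_combo A' P' A' P' (by norm_num : (1 / 2 : ℝ) + 1 / 2 = 1)]; simp
  set s := sideFn A' P' (emb.dartCentre d) with hs_def
  have hs : s ≠ 0 := sideFn_dartCentre_ne_zero hiso d hp
  -- both rhombi lie in `{0 ≤ -s · g}` and have the side on the line
  have key : ∀ {d₀ : G.Dart} (_ : d₀.edge ≠ d.edge) {p₀ : V × F} (_ : p₀ ∈ emb.dartSides d₀)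
      (_ : ({emb.z p₀.1, emb.c p₀.2} : Set ℂ) = {emb.z p.1, emb.c p.2}),
      ∃ r > 0, ball m r ∩ {Y | 0 < -s * sideFn A' P' Y} ⊆
        interior (emb.rhombus ⟨d₀.edge, d₀.edge_mem⟩) := by
    intro d₀ h₀ p₀ hp₀ hs₀
    have hopen : openSegment ℝ (emb.z p₀.1) (emb.c p₀.2) = openSegment ℝ A' P' :=
      FaultLine.openSegment_eq_of_pair_eq hs₀
    have hm₀ : m ∈ openSegment ℝ (emb.z p₀.1) (emb.c p₀.2) := by rw [hopen]; exact hm_open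
    have hmK : m ∈ emb.rhombus ⟨d₀.edge, d₀.edge_mem⟩ :=
      FaultLine.segment_side_subset_rhombus hiso hp₀ (openSegment_subset_segment ℝ _ _ hm₀)
    have hout := rhombus_subset_sideOuter hiso H.tiling d d₀ h₀ hp hm_open hmK
    have hT : emb.rhombus ⟨d₀.edge, d₀.edge_mem⟩ ⊆ {Y | 0 ≤ -s * sideFn A' P' Y} := by
      intro Y hY
      have h := hout hY
      change sideFn A' P' Y * s ≤ 0 at h
      show 0 ≤ -s * sideFn A' P' Y
      linarith [mul_comm (sideFn A' P' Y) s]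
    have hg1 : sideFn A' P' (emb.z p₀.1) = 0 := by
      have : emb.z p₀.1 ∈ ({A', P'} : Set ℂ) := by rw [← hs₀]; simp
      rcases this with h | h
      · rw [h, sideFn_left]
      · rw [mem_singleton_iff] at h; rw [h, sideFn_right]
    have hg2 : sideFn A' P' (emb.c p₀.2) = 0 := by
      have : emb.c p₀.2 ∈ ({A', P'} : Set ℂ) := by rw [← hs₀]; simp
      rcases this with h | h
      · rw [h, sideFn_left]
      · rw [mem_singleton_iff] at h; rw [h, sideFn_right]
    obtain ⟨-, hconv2, -⟩ := FaultLine.halfPlane_conv hiso hAP (neg_ne_zero.2 hs) hT hp₀ hg1 hg2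
    obtain ⟨r, hr, -, hint⟩ := exists_ball_inter_sideInner_subset hiso d₀ hp₀ hm₀
    exact ⟨r, hr, fun Y hY => hint ⟨hY.1, hconv2 hY.2⟩⟩
  obtain ⟨r₁, hr₁, hsub₁⟩ := key h₁ hp₁ hs₁
  obtain ⟨r₂, hr₂, hsub₂⟩ := key h₂ hp₂ hs₂
  -- a common interior point just across the side
  set ρ : ℝ := min r₁ r₂ / (2 * (|s| + 1)) with hρ
  have hρpos : 0 < ρ := by positivity
  set Y₀ : ℂ := m + ((-s * ρ : ℝ) : ℂ) * (I * (P' - A')) with hY₀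
  have hgY₀ : sideFn A' P' Y₀ = -s * ρ := by
    have hw1 : (I * (P' - A') * conj (P' - A')).im = 1 := by
      have hn : ‖P' - A'‖ = 1 := by rw [norm_sub_rev]; exact hAP1
      rw [mul_assoc, Complex.mul_conj, Complex.normSq_eq_norm_sq, hn]; simp
    rw [hY₀, sideFn_add_smul, hgm, hw1]; ring
  have hpos : 0 < -s * sideFn A' P' Y₀ := by
    rw [hgY₀]
    have : -s * (-s * ρ) = s * s * ρ := by ring
    rw [this]; exact mul_pos (mul_self_pos.2 hs) hρpos
  have hdist : dist Y₀ m < min r₁ r₂ := by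
    rw [dist_eq_norm]
    have : Y₀ - m = ((-s * ρ : ℝ) : ℂ) * (I * (P' - A')) := by rw [hY₀]; ring
    rw [this, norm_mul, norm_mul, Complex.norm_real, Complex.norm_I, one_mul, norm_sub_rev,
      hAP1, mul_one, Real.norm_eq_abs, abs_mul, abs_neg, abs_of_pos hρpos, hρ]
    have hmin : 0 < min r₁ r₂ := lt_min hr₁ hr₂
    calc |s| * (min r₁ r₂ / (2 * (|s| + 1))) = (|s| / (|s| + 1)) * (min r₁ r₂ / 2) := by
          field_simp
      _ < 1 * (min r₁ r₂ / 2) := by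
          apply mul_lt_mul_of_pos_right _ (by linarith)
          rw [div_lt_one (by positivity)]; linarith
      _ < min r₁ r₂ := by linarith
  have hY₁ : Y₀ ∈ interior (emb.rhombus ⟨d₁.edge, d₁.edge_mem⟩) :=
    hsub₁ ⟨mem_ball.2 (lt_of_lt_of_le hdist (min_le_left _ _)), hpos⟩
  have hY₂ : Y₀ ∈ interior (emb.rhombus ⟨d₂.edge, d₂.edge_mem⟩) :=
    hsub₂ ⟨mem_ball.2 (lt_of_lt_of_le hdist (min_le_right _ _)), hpos⟩
  by_contra hne
  have hne' : (⟨d₁.edge, d₁.edge_mem⟩ : G.edgeSet) ≠ ⟨d₂.edge, d₂.edge_mem⟩ :=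
    fun h => hne (congrArg Subtype.val h)
  exact Set.disjoint_left.1 (H.tiling.disjoint_interior hne') hY₁ hY₂

end EdgeToEdge

/-! ### The edge across a side -/

section AcrossEdge

/-- The set of sides of an edge is the set of sides of its reference dart (tree definition).
[folklore] -/
theorem mem_sides_iff_mem_dartSides (e : G.edgeSet) (p : V × F) :
    p ∈ emb.sides e ↔ p ∈ emb.dartSides (RhombicEmbedding.refDart e) := Iff.rfl

omit [DecidableEq V] [DecidableEq F] in
/-- The rhombus of the reference dart is the rhombus of the edge. [folklore] -/
theorem rhombus_refDart (e : G.edgeSet) :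
    emb.rhombus ⟨(RhombicEmbedding.refDart e).edge, (RhombicEmbedding.refDart e).edge_mem⟩ =
      emb.rhombus e := by
  congr 1; exact Subtype.ext (RhombicEmbedding.refDart_edge e)

/-- **Edge-to-edge, for edges**: across the side `p` of the rhombus of `e` there is a unique
other edge whose rhombus has the same segment as a side.
[cite: GrimmettManolescu2014Isoradial, §4.1–4.2 (each side of a rhombus is shared with exactly one other rhombus)] -/
theorem existsUnique_acrossEdge (H : PlanarTilingHyps emb ε) (e : G.edgeSet) {p : V × F}
    (hp : p ∈ emb.sides e) :
    ∃! e' : G.edgeSet, e' ≠ e ∧ ∃ p' ∈ emb.sides e',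
      ({emb.z p'.1, emb.c p'.2} : Set ℂ) = {emb.z p.1, emb.c p.2} := by
  set d := RhombicEmbedding.refDart e with hd
  have hde : d.edge = (e : Sym2 V) := RhombicEmbedding.refDart_edge e
  obtain ⟨d', hne, p', hp', hs'⟩ := EdgeToEdge.exists_across H d hp
  refine ⟨⟨d'.edge, d'.edge_mem⟩, ⟨?_, p', ?_, hs'⟩, ?_⟩
  · intro h; apply hne; rw [hde]; exact congrArg Subtype.val h
  · rw [emb.sides_eq_dartSides H.iso (rfl : d'.edge = ((⟨d'.edge, d'.edge_mem⟩ : G.edgeSet) : Sym2 V))]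
    exact hp'
  · rintro e₂ ⟨hne₂, p₂, hp₂, hs₂⟩
    set d₂ := RhombicEmbedding.refDart e₂ with hd₂
    have hd₂e : d₂.edge = (e₂ : Sym2 V) := RhombicEmbedding.refDart_edge e₂
    have h₂ : d₂.edge ≠ d.edge := by
      rw [hd₂e, hde]; exact fun h => hne₂ (Subtype.ext h)
    have := EdgeToEdge.edge_eq_of_across H d hp h₂ hne hp₂ hp' hs₂ hs'
    apply Subtype.ext
    rw [← hd₂e, this]

/-- **The edge across the side `p` of the rhombus of `e`** (the other edge whose rhombus has the
same segment as a side; `e` itself if `p` is not a side of `e`).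
[cite: GrimmettManolescu2014Isoradial, §4.1–4.2 (the next rhombus of a track)] -/
def acrossEdge (H : PlanarTilingHyps emb ε) (e : G.edgeSet) (p : V × F) : G.edgeSet :=
  if hp : p ∈ emb.sides e then Classical.choose (existsUnique_acrossEdge H e hp).exists else e

/-- The edge across a side is another edge. [cite: GrimmettManolescu2014Isoradial, §4.1–4.2 (the next rhombus of a track)] -/
theorem acrossEdge_ne (H : PlanarTilingHyps emb ε) (e : G.edgeSet) {p : V × F}
    (hp : p ∈ emb.sides e) : acrossEdge H e p ≠ e := by
  rw [acrossEdge, dif_pos hp]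
  exact (Classical.choose_spec (existsUnique_acrossEdge H e hp).exists).1

/-- The rhombus across a side has the same segment as a side.
[cite: GrimmettManolescu2014Isoradial, §4.1–4.2 (the next rhombus of a track)] -/
theorem exists_side_acrossEdge (H : PlanarTilingHyps emb ε) (e : G.edgeSet) {p : V × F}
    (hp : p ∈ emb.sides e) :
    ∃ p' ∈ emb.sides (acrossEdge H e p), ({emb.z p'.1, emb.c p'.2} : Set ℂ) = {emb.z p.1, emb.c p.2} := by
  rw [acrossEdge, dif_pos hp]
  exact (Classical.choose_spec (existsUnique_acrossEdge H e hp).exists).2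

/-- **Uniqueness of the edge across**: any other edge whose rhombus has the segment of the side
`p` of `e` as a side is `acrossEdge H e p`. [cite: GrimmettManolescu2014Isoradial, §4.1–4.2 (each side of a rhombus is shared with exactly one other rhombus)] -/
theorem eq_acrossEdge (H : PlanarTilingHyps emb ε) (e : G.edgeSet) {p : V × F}
    (hp : p ∈ emb.sides e) {e' : G.edgeSet} (hne : e' ≠ e) {p' : V × F} (hp' : p' ∈ emb.sides e')
    (hs : ({emb.z p'.1, emb.c p'.2} : Set ℂ) = {emb.z p.1, emb.c p.2}) :
    e' = acrossEdge H e p := by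
  obtain ⟨p'', hp'', hs''⟩ := exists_side_acrossEdge H e hp
  exact (existsUnique_acrossEdge H e hp).unique ⟨hne, p', hp', hs⟩
    ⟨acrossEdge_ne H e hp, p'', hp'', hs''⟩

/-- **Going across twice returns**: if `p'` is the side of `acrossEdge H e p` with the same
segment as `p`, then across `p'` lies `e`. [cite: GrimmettManolescu2014Isoradial, §4.1–4.2 (each side of a rhombus is shared with exactly one other rhombus)] -/
theorem acrossEdge_acrossEdge (H : PlanarTilingHyps emb ε) (e : G.edgeSet) {p : V × F}
    (hp : p ∈ emb.sides e) {p' : V × F} (hp' : p' ∈ emb.sides (acrossEdge H e p))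
    (hs : ({emb.z p'.1, emb.c p'.2} : Set ℂ) = {emb.z p.1, emb.c p.2}) :
    acrossEdge H (acrossEdge H e p) p' = e :=
  (eq_acrossEdge H (acrossEdge H e p) hp' (acrossEdge_ne H e hp).symm hp hs.symm).symm

end AcrossEdge

end Literature.Probability.Percolation

end
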